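import Literature.Geometry.Lorentzian.BogovskiiKernelK1
import Literature.Geometry.Lorentzian.BogovskiiDiagonalL2
import Literature.Geometry.Lorentzian.BogovskiiTensorL2Bound
import Literature.Analysis.SingularIntegrals.SchurTest
import Literature.Analysis.FluidPDE.NewtonPotentialHolder
import HarnessLib

/-!
# (S3), gain of two derivatives: the decomposition of `∂_a S_η(∂_b f)` and its `L²` bounds

(trunk G08 = T-LORENTZ; family `gr`; namespace `Literature.Geometry.Lorentzian.MaoOhTao`.)

Mao–Oh–Tao (arXiv:2308.13031), Lemma 2.3 (S3): `S_η : L²(B̄_ρ) → Ḣ²`.  The gain-two term is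
`∂_a S_η(∂_b f)(x) = ∫ K₁[η](x − y; y) ∂_b f(y) dy` (`BogovskiiKernelK1`).  With the smooth truncation
`θ_ε = radialCutoff ε (2ε)`:

* `∂_a S_η(∂_b f) = N_ε + F_ε` (`pd_bogovskiiS_pd_eq_add`): `N_ε` carries `θ_ε(x − y)K₁`, `F_ε` carries `(1 − θ_ε)K₁`;
* `F_ε = A_ε − B_ε − L_ε` (`integral_truncK1_section_mul_pd_eq`): one integration by parts in `y` against the
  everywhere-`C¹` truncated section `u(y) = (1 − θ_ε(x − y))K₁(x − y; y)`, whose derivative is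
  `∂_{y_b}u = (∂_bθ_ε)(x − y)K₁ − (1 − θ_ε)K₂[η](x − y; y) + (1 − θ_ε)K₁[∂_bη](x − y; y)` (`fderiv_truncK1_section_e`,
  from `∂_{y_b}[K₁(x − y; y)] = −K₂ + K₁[∂_bη]`, `fderiv_bogovskiiK1_section_e`);
* `A_ε = 1_{B̄}(T_ε[η](x, x) + E_ε)` (`czTerm_eq_frozen_add`): the base point is frozen at the output point, `T_ε` the
  frozen truncated operator of `BogovskiiFrozenOperator`, `E_ε` the freezing error with kernel
  `|K₂(x − y; y) − K₂(x − y; x)| ≲ |x − y|⁻²`;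
* Schur bounds (`lintegral_sq_le_of_conv_majorant`): `‖N_ε‖₂ ≤ 9|B₁|A'ε‖∂_bf‖₂` (small), and `B_ε`, `L_ε`,
  `1_{B̄}E_ε` bounded on `L²` uniformly in `ε`;
* `exists_czConst_pd_bogovskiiS_pd`: with the diagonal bound `exists_diagFrozenOp_l2Const`,
  `∫ |∂_a S_η(∂_b f)|² ≤ C ∫ |f|²`, letting `ε → 0`;
* `exists_h2Const_bogovskiiS`: **(S3), gain two** — `∫ |∂_a∂_b (S_η f)ᵢⱼ|² ≤ C ∫ |f|²` for `f ∈ C²_c(B̄_ρ)`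
  (`∂_a∂_b S_η f = ∂_a S_{∂_bη} f + ∂_a S_η(∂_b f)` and the gain-one bound `exists_h1Const_bogovskiiS`).

## References

* Y. Mao, S.-J. Oh, T. Tao, arXiv:2308.13031 (2023), Lemma 2.3, pp. 8–9 (key `MaoOhTao2023`).
* L. Grafakos, *Classical Fourier Analysis*, 3rd ed., Thm. 5.4.1; *Modern Fourier Analysis*, App. A.2 (Schur).
-/

noncomputable section

open scoped RealInnerProductSpace Topology ENNReal
open Filter MeasureTheory Set Metric Function
open Literature.Analysis.FluidPDE

namespace Literature.Geometry.Lorentzian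

namespace MaoOhTao

section Section

variable {ψ η : E3 → ℝ} {R : ℝ}

/-- **`y ↦ Q_m[ψ](x − y; y)` is differentiable at `y₀ ≠ x`**, with
`D = ∫_1^∞ ((1 − s) s^m) • Dψ(s(x − y₀) + y₀) ds` (`s(x − y) + y = sx + (1 − s)y`). [folklore] -/
theorem hasFDerivAt_bogovskiiQ_section (hψ : ContDiff ℝ 1 ψ) (hR : ∀ z : E3, R < ‖z‖ → ψ z = 0) (m : ℕ) (x : E3)
    {y₀ : E3} (hy₀ : y₀ ≠ x) :
    HasFDerivAt (fun y : E3 ↦ bogovskiiQ ψ y m (x - y))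
      (∫ s in Ioi (1 : ℝ), ((1 - s) * s ^ m) • fderiv ℝ ψ (s • (x - y₀) + y₀)) y₀ := by
  have hψc : Continuous ψ := hψ.continuous
  have hdc : Continuous (fderiv ℝ ψ) := hψ.continuous_fderiv one_ne_zero
  obtain ⟨M', hM'⟩ := hdc.bounded_above_of_compact_support ((HasCompactSupport.intro (isCompact_closedBall (0 : E3) R)
    fun z hz ↦ hR z (by rwa [mem_closedBall, dist_zero_right, not_le] at hz)).fderiv (𝕜 := ℝ))
  have hM'0 : 0 ≤ M' := (norm_nonneg _).trans (hM' 0)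
  have hd₀ : 0 < ‖x - y₀‖ := norm_pos_iff.2 (sub_ne_zero.2 (Ne.symm hy₀))
  set r : ℝ := ‖x - y₀‖ / 2 with hr
  have hr0 : 0 < r := by positivity
  set Y : ℝ := ‖y₀‖ + r with hY
  set S₀ : ℝ := max (R + Y) 0 / r with hS₀
  have hS₀0 : 0 ≤ S₀ := div_nonneg (le_max_right _ _) hr0.le
  have hzlow : ∀ y ∈ ball y₀ r, r ≤ ‖x - y‖ := by
    intro y hy
    rw [mem_ball, dist_eq_norm] at hy
    have : ‖x - y₀‖ ≤ ‖x - y‖ + ‖y - y₀‖ := by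
      calc ‖x - y₀‖ = ‖(x - y) + (y - y₀)‖ := by rw [sub_add_sub_cancel]
        _ ≤ ‖x - y‖ + ‖y - y₀‖ := norm_add_le _ _
    linarith
  have hYy : ∀ y ∈ ball y₀ r, ‖y‖ ≤ Y := by
    intro y hy
    rw [mem_ball, dist_eq_norm] at hy
    have := norm_le_insert' y y₀
    linarith
  have hvan : ∀ y ∈ ball y₀ r, ∀ s : ℝ, S₀ < |s| → R + ‖y‖ < |s| * ‖x - y‖ := by
    intro y hy s hs
    rw [hS₀, div_lt_iff₀ hr0] at hs
    calc R + ‖y‖ ≤ R + Y := by linarith [hYy y hy]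
      _ ≤ max (R + Y) 0 := le_max_left _ _
      _ < |s| * r := hs
      _ ≤ |s| * ‖x - y‖ := mul_le_mul_of_nonneg_left (hzlow y hy) (abs_nonneg s)
  set F : E3 → ℝ → ℝ := fun y s ↦ ψ (s • (x - y) + y) * s ^ m with hF
  set F' : E3 → ℝ → (E3 →L[ℝ] ℝ) := fun y s ↦ ((1 - s) * s ^ m) • fderiv ℝ ψ (s • (x - y) + y) with hF'
  have hFc : ∀ y, Continuous (F y) := fun y ↦
    (hψc.comp (((continuous_id.smul continuous_const).add continuous_const))).mul (continuous_pow m)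
  have hF'c : ∀ y, Continuous (F' y) := fun y ↦
    ((continuous_const.sub continuous_id).mul (continuous_pow m)).smul
      (hdc.comp ((continuous_id.smul continuous_const).add continuous_const))
  have hF_meas : ∀ᶠ y in 𝓝 y₀, AEStronglyMeasurable (F y) (volume.restrict (Ioi 1)) :=
    Eventually.of_forall fun y ↦ (hFc y).aestronglyMeasurable
  have hF_int : Integrable (F y₀) (volume.restrict (Ioi 1)) := by
    refine ((hFc y₀).integrable_of_hasCompactSupport (HasCompactSupport.intro (isCompact_Icc (a := -S₀) (b := S₀))
      fun s hs ↦ ?_)).restrict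
    have hs' : S₀ < |s| := by
      by_contra hle
      exact hs (abs_le.1 (not_lt.1 hle))
    show ψ (s • (x - y₀) + y₀) * s ^ m = 0
    rw [eta_ray_eq_zero hR (hvan y₀ (mem_ball_self hr0) s hs'), zero_mul]
  have hF'_meas : AEStronglyMeasurable (F' y₀) (volume.restrict (Ioi 1)) := (hF'c y₀).aestronglyMeasurable
  have h_bound : ∀ᵐ s ∂(volume.restrict (Ioi 1)), ∀ y ∈ ball y₀ r, ‖F' y s‖ ≤
      (Icc (-S₀) S₀).indicator (fun _ ↦ (1 + S₀) * S₀ ^ m * M') s := by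
    refine ae_of_all _ fun s y hy ↦ ?_
    by_cases hs : s ∈ Icc (-S₀) S₀
    · rw [indicator_of_mem hs, hF', norm_smul, Real.norm_eq_abs, abs_mul, abs_pow]
      have hs' : |s| ≤ S₀ := abs_le.2 ⟨hs.1, hs.2⟩
      have h1s : |1 - s| ≤ 1 + S₀ := by
        calc |1 - s| ≤ |1| + |s| := abs_sub _ _
          _ ≤ 1 + S₀ := by rw [abs_one]; linarith
      exact mul_le_mul (mul_le_mul h1s (pow_le_pow_left₀ (abs_nonneg s) hs' m) (by positivity) (by positivity))
        (hM' _) (norm_nonneg _) (by positivity)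
    · rw [indicator_of_notMem hs]
      have hs' : S₀ < |s| := by
        by_contra hle
        exact hs (abs_le.1 (not_lt.1 hle))
      simp only [hF']
      rw [fderiv_eta_ray_eq_zero hR (hvan y hy s hs'), smul_zero, norm_zero]
  have hbi : Integrable (fun s : ℝ ↦ (Icc (-S₀) S₀).indicator (fun _ ↦ (1 + S₀) * S₀ ^ m * M') s)
      (volume.restrict (Ioi 1)) :=
    ((integrable_indicator_iff measurableSet_Icc).2 continuous_const.integrableOn_Icc).restrict
  have h_diff : ∀ᵐ s ∂(volume.restrict (Ioi 1)), ∀ y ∈ ball y₀ r, HasFDerivAt (F · s) (F' y s) y := by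
    refine ae_of_all _ fun s y _ ↦ ?_
    have h1 : HasFDerivAt (fun y : E3 ↦ s • (x - y) + y) ((1 - s) • ContinuousLinearMap.id ℝ E3) y := by
      have h := (((hasFDerivAt_const (𝕜 := ℝ) x y).sub (hasFDerivAt_id y)).const_smul s).add (hasFDerivAt_id y)
      refine h.congr_fderiv ?_
      ext v
      simp
      ring
    have h2 : HasFDerivAt ψ (fderiv ℝ ψ (s • (x - y) + y)) (s • (x - y) + y) :=
      (hψ.differentiable one_ne_zero _).hasFDerivAt
    have h3 := (HasFDerivAt.comp y (f := fun y : E3 ↦ s • (x - y) + y) h2 h1).mul_const (s ^ m)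
    have heq : (s ^ m) • (fderiv ℝ ψ (s • (x - y) + y)).comp ((1 - s) • ContinuousLinearMap.id ℝ E3) = F' y s := by
      ext v
      simp [hF']
      ring
    rw [← heq]
    simpa only [Function.comp_def] using h3
  have hmain := hasFDerivAt_integral_of_dominated_of_fderiv_le (ball_mem_nhds y₀ hr0) hF_meas hF_int hF'_meas
    h_bound hbi h_diff
  simpa only [bogovskiiQ_apply] using hmain

/-- **Directional derivatives of the section**: `∂_{y_a}[Q_m[ψ](x − y; y)] = Q_m[∂_aψ](x − y; y) − Q_{m+1}[∂_aψ](x − y; y)`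
(base-point derivative minus `z`-derivative). [folklore] -/
theorem fderiv_bogovskiiQ_section_e (hψ : ContDiff ℝ 1 ψ) (hR : ∀ z : E3, R < ‖z‖ → ψ z = 0) (m : ℕ) (x : E3)
    {y : E3} (hy : y ≠ x) (a : Fin 3) :
    DifferentiableAt ℝ (fun y : E3 ↦ bogovskiiQ ψ y m (x - y)) y ∧
      fderiv ℝ (fun y : E3 ↦ bogovskiiQ ψ y m (x - y)) y (e a) =
        bogovskiiQ (pd a ψ) y m (x - y) - bogovskiiQ (pd a ψ) y (m + 1) (x - y) := by
  have h := hasFDerivAt_bogovskiiQ_section hψ hR m x hy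
  refine ⟨h.differentiableAt, ?_⟩
  have hxy : x - y ≠ 0 := sub_ne_zero.2 (Ne.symm hy)
  have hint1 : Integrable (fun s : ℝ ↦ (s ^ m) • fderiv ℝ ψ (s • (x - y) + y)) (volume.restrict (Ioi 1)) :=
    integrable_pow_smul_fderiv_ray' hψ hR y m hxy
  have hint2 : Integrable (fun s : ℝ ↦ (s ^ (m + 1)) • fderiv ℝ ψ (s • (x - y) + y)) (volume.restrict (Ioi 1)) :=
    integrable_pow_smul_fderiv_ray hψ hR y m hxy
  have hsplit : (fun s : ℝ ↦ ((1 - s) * s ^ m) • fderiv ℝ ψ (s • (x - y) + y)) =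
      fun s ↦ (s ^ m) • fderiv ℝ ψ (s • (x - y) + y) - (s ^ (m + 1)) • fderiv ℝ ψ (s • (x - y) + y) := by
    funext s; rw [← sub_smul]; congr 1; ring
  rw [h.fderiv, hsplit, integral_sub hint1 hint2, _root_.sub_apply,
    ContinuousLinearMap.integral_apply hint1, ContinuousLinearMap.integral_apply hint2, bogovskiiQ_apply,
    bogovskiiQ_apply]
  congr 1
  · refine integral_congr_ae (ae_of_all _ fun s ↦ ?_)
    simp only [FunLike.coe_smul, Pi.smul_apply, smul_eq_mul, pd]; ring
  · refine integral_congr_ae (ae_of_all _ fun s ↦ ?_)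
    simp only [FunLike.coe_smul, Pi.smul_apply, smul_eq_mul, pd]; ring

/-- **Derivative of the section of `K₁`**: for `η ∈ C²` and `y ≠ x`,
`∂_{y_b}[K₁[η](x − y; y)] = −K₂[η](x − y; y) + K₁[∂_bη](x − y; y)`. [cite: MaoOhTao2023, Lemma 2.3] -/
theorem fderiv_bogovskiiK1_section_e (hη : ContDiff ℝ 2 η) (hR : ∀ z : E3, R < ‖z‖ → η z = 0) (i j a : Fin 3)
    (x : E3) {y : E3} (hy : y ≠ x) (b : Fin 3) :
    DifferentiableAt ℝ (fun y : E3 ↦ bogovskiiK1 η y i j a (x - y)) y ∧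
      fderiv ℝ (fun y : E3 ↦ bogovskiiK1 η y i j a (x - y)) y (e b) =
        -bogovskiiK2 η y i j a b (x - y) + bogovskiiK1 (pd b η) y i j a (x - y) := by
  have h1 : ContDiff ℝ 1 η := hη.of_le (by norm_cast)
  obtain ⟨haη, hRa⟩ := contDiff_pd_and_vanish (n := 1) hη hR a
  obtain ⟨dQ2, fQ2⟩ := fderiv_bogovskiiQ_section_e h1 hR 2 x hy b
  obtain ⟨dQ3, fQ3⟩ := fderiv_bogovskiiQ_section_e haη hRa 3 x hy b
  -- the polynomial factors
  have hci : ∀ c : Fin 3, HasFDerivAt (fun y : E3 ↦ (x - y) c) (-(EuclideanSpace.proj (𝕜 := ℝ) c : E3 →L[ℝ] ℝ)) y := by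
    intro c
    have := ((hasFDerivAt_const (𝕜 := ℝ) x y).sub (hasFDerivAt_id y))
    have h2 := (EuclideanSpace.proj (𝕜 := ℝ) c).hasFDerivAt.comp y this
    refine h2.congr_fderiv ?_
    ext v
    simp
  have dxi : DifferentiableAt ℝ (fun y : E3 ↦ (x - y) i) y := (hci i).differentiableAt
  have dxj : DifferentiableAt ℝ (fun y : E3 ↦ (x - y) j) y := (hci j).differentiableAt
  have fxi : ∀ c, fderiv ℝ (fun y : E3 ↦ (x - y) c) y (e b) = -(if c = b then 1 else 0) := by
    intro c
    rw [(hci c).fderiv]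
    simp [e, PiLp.single_apply]
  have dL : DifferentiableAt ℝ (fun y : E3 ↦ (if i = a then (1 : ℝ) else 0) * (x - y) j + (if j = a then 1 else 0) * (x - y) i) y :=
    (dxj.const_mul _).add (dxi.const_mul _)
  have dLj : DifferentiableAt ℝ (fun y : E3 ↦ (if i = a then (1 : ℝ) else 0) * (x - y) j) y := dxj.const_mul _
  have dLi : DifferentiableAt ℝ (fun y : E3 ↦ (if j = a then (1 : ℝ) else 0) * (x - y) i) y := dxi.const_mul _
  have dP : DifferentiableAt ℝ (fun y : E3 ↦ (x - y) i * (x - y) j) y := dxi.mul dxj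
  have dT1 : DifferentiableAt ℝ (fun y : E3 ↦ ((if i = a then (1 : ℝ) else 0) * (x - y) j +
      (if j = a then 1 else 0) * (x - y) i) * bogovskiiQ η y 2 (x - y)) y := dL.mul dQ2
  have dT2 : DifferentiableAt ℝ (fun y : E3 ↦ (x - y) i * (x - y) j * bogovskiiQ (pd a η) y 3 (x - y)) y := dP.mul dQ3
  have hK : (fun y : E3 ↦ bogovskiiK1 η y i j a (x - y)) = fun y ↦ ((if i = a then (1 : ℝ) else 0) * (x - y) j +
      (if j = a then 1 else 0) * (x - y) i) * bogovskiiQ η y 2 (x - y) +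
      (x - y) i * (x - y) j * bogovskiiQ (pd a η) y 3 (x - y) := rfl
  refine ⟨by rw [hK]; exact dT1.add dT2, ?_⟩
  rw [hK, fderiv_fun_add dT1 dT2, fderiv_fun_mul dL dQ2, fderiv_fun_mul dP dQ3, fderiv_fun_add dLj dLi,
    fderiv_const_mul dxj, fderiv_const_mul dxi, fderiv_fun_mul dxi dxj]
  simp only [_root_.add_apply, _root_.smul_apply, smul_eq_mul, fQ2, fQ3, fxi]
  have c1 : pd b (pd a η) = pd a (pd b η) := funext fun z ↦ pd_pd_comm hη.contDiffAt b a
  simp only [bogovskiiK2, bogovskiiK1, c1]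
  ring

end Section


section TruncatedSection

variable {η : E3 → ℝ} {R ε : ℝ}

/-- A continuous function vanishing on a ball around `c` times a function continuous off `c` is continuous.
[folklore] -/
theorem continuous_mul_of_eqOn_ball_pt {u v : E3 → ℝ} {c : E3} (hu : Continuous u) {δ : ℝ} (hδ : 0 < δ)
    (huc : ∀ y : E3, ‖c - y‖ < δ → u y = 0) (hv : ContinuousOn v {c}ᶜ) : Continuous fun y ↦ u y * v y := by
  rw [continuous_iff_continuousAt]
  intro y
  by_cases hy : ‖c - y‖ < δ
  · have hev : (fun w ↦ u w * v w) =ᶠ[𝓝 y] fun _ ↦ 0 := by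
      have ho : IsOpen {w : E3 | ‖c - w‖ < δ} := isOpen_lt (continuous_const.sub continuous_id).norm continuous_const
      filter_upwards [ho.mem_nhds hy] with w hw
      rw [huc w hw, zero_mul]
    exact continuousAt_const.congr hev.symm
  · have hyc : y ≠ c := by
      intro h; rw [h, sub_self, norm_zero] at hy; exact hy hδ
    exact hu.continuousAt.mul (hv.continuousAt (isOpen_compl_singleton.mem_nhds hyc))

/-- The section `y ↦ K₂[η](x − y; y)` is continuous at `y ≠ x` (`η ∈ C³`). [folklore] -/
theorem continuousAt_bogovskiiK2_section (hη : ContDiff ℝ 3 η) (hR : ∀ z : E3, R < ‖z‖ → η z = 0) (i j a b : Fin 3)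
    (x : E3) {y : E3} (hy : y ≠ x) : ContinuousAt (fun y : E3 ↦ bogovskiiK2 η y i j a b (x - y)) y := by
  have h1 : ContDiff ℝ 1 η := hη.of_le (by norm_cast)
  obtain ⟨haη, hRa⟩ := contDiff_pd_and_vanish (n := 2) hη hR a
  obtain ⟨hbη, hRb⟩ := contDiff_pd_and_vanish (n := 2) hη hR b
  obtain ⟨hbaη, hRba⟩ := contDiff_pd_and_vanish (n := 1) haη hRa b
  have cQ2 := (hasFDerivAt_bogovskiiQ_section h1 hR 2 x hy).continuousAt
  have cQ3b := (hasFDerivAt_bogovskiiQ_section (hbη.of_le (by norm_cast)) hRb 3 x hy).continuousAt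
  have cQ3a := (hasFDerivAt_bogovskiiQ_section (haη.of_le (by norm_cast)) hRa 3 x hy).continuousAt
  have cQ4 := (hasFDerivAt_bogovskiiQ_section hbaη hRba 4 x hy).continuousAt
  have cxi : ContinuousAt (fun y : E3 ↦ (x - y) i) y :=
    ((EuclideanSpace.proj (𝕜 := ℝ) i).continuous.comp (continuous_const.sub continuous_id)).continuousAt
  have cxj : ContinuousAt (fun y : E3 ↦ (x - y) j) y :=
    ((EuclideanSpace.proj (𝕜 := ℝ) j).continuous.comp (continuous_const.sub continuous_id)).continuousAt
  unfold bogovskiiK2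
  exact (((continuousAt_const.mul cQ2).add (((continuousAt_const.mul cxj).add (continuousAt_const.mul cxi)).mul
    cQ3b)).add (((continuousAt_const.mul cxj).add (continuousAt_const.mul cxi)).mul cQ3a)).add ((cxi.mul cxj).mul cQ4)

/-- The section `y ↦ K₁[η](x − y; y)` is continuous off `x` (`η ∈ C²`). [folklore] -/
theorem continuousOn_bogovskiiK1_section (hη : ContDiff ℝ 2 η) (hR : ∀ z : E3, R < ‖z‖ → η z = 0) (i j a : Fin 3)
    (x : E3) : ContinuousOn (fun y : E3 ↦ bogovskiiK1 η y i j a (x - y)) {x}ᶜ := fun _ hy ↦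
  ((fderiv_bogovskiiK1_section_e hη hR i j a x hy a).1).continuousAt.continuousWithinAt

/-- **The truncated section `u(y) = (1 − θ_ε(x − y)) K₁[η](x − y; y)` is differentiable everywhere**, with
`∂_{y_b} u = (∂_bθ_ε)(x − y) K₁ − (1 − θ_ε(x − y)) K₂[η](x − y; y) + (1 − θ_ε(x − y)) K₁[∂_bη](x − y; y)`.
[cite: MaoOhTao2023, Lemma 2.3 (S3)] -/
theorem fderiv_truncK1_section_e (hη : ContDiff ℝ 2 η) (hR : ∀ z : E3, R < ‖z‖ → η z = 0) (hε : 0 < ε)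
    (i j a b : Fin 3) (x y : E3) :
    DifferentiableAt ℝ (fun y : E3 ↦ (1 - radialCutoff ε (2 * ε) (x - y)) * bogovskiiK1 η y i j a (x - y)) y ∧
      fderiv ℝ (fun y : E3 ↦ (1 - radialCutoff ε (2 * ε) (x - y)) * bogovskiiK1 η y i j a (x - y)) y (e b) =
        fderiv ℝ (radialCutoff ε (2 * ε)) (x - y) (e b) * bogovskiiK1 η y i j a (x - y) -
          (1 - radialCutoff ε (2 * ε) (x - y)) * bogovskiiK2 η y i j a b (x - y) +
          (1 - radialCutoff ε (2 * ε) (x - y)) * bogovskiiK1 (pd b η) y i j a (x - y) := by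
  have hθs : ContDiff ℝ 1 (radialCutoff ε (2 * ε) : E3 → ℝ) := radialCutoff_contDiff ε (2 * ε)
  by_cases hxy : ‖x - y‖ < ε
  · -- `u` vanishes near `y`
    have ho : IsOpen {w : E3 | ‖x - w‖ < ε} := isOpen_lt (continuous_const.sub continuous_id).norm continuous_const
    have hev : (fun y : E3 ↦ (1 - radialCutoff ε (2 * ε) (x - y)) * bogovskiiK1 η y i j a (x - y)) =ᶠ[𝓝 y]
        fun _ ↦ 0 := by
      filter_upwards [ho.mem_nhds hxy] with w hw
      rw [radialCutoff_eq_one hε.le (by linarith) hw.le, sub_self, zero_mul]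
    refine ⟨(differentiableAt_const (0 : ℝ)).congr_of_eventuallyEq hev, ?_⟩
    rw [hev.fderiv_eq, fderiv_const_apply, _root_.zero_apply,
      Literature.Analysis.SingularIntegrals.fderiv_radialCutoff_eq_zero_of_lt hε.le (by linarith) hxy,
      radialCutoff_eq_one hε.le (by linarith) hxy.le]
    simp
  · have hyx : y ≠ x := by
      intro h; rw [h, sub_self, norm_zero] at hxy; exact hxy hε
    obtain ⟨dK, fK⟩ := fderiv_bogovskiiK1_section_e hη hR i j a x hyx b
    have hg : HasFDerivAt (fun y : E3 ↦ 1 - radialCutoff ε (2 * ε) (x - y))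
        ((fderiv ℝ (radialCutoff ε (2 * ε)) (x - y)).comp (ContinuousLinearMap.id ℝ E3)) y := by
      have h1 : HasFDerivAt (fun y : E3 ↦ x - y) (-(ContinuousLinearMap.id ℝ E3)) y := by
        have := (hasFDerivAt_const (𝕜 := ℝ) x y).sub (hasFDerivAt_id y)
        refine this.congr_fderiv ?_
        ext v; simp
      have h2 := ((hθs.differentiable one_ne_zero) (x - y)).hasFDerivAt.comp y h1
      have h3 := (hasFDerivAt_const (1 : ℝ) y).sub h2
      refine h3.congr_fderiv ?_
      ext v
      simp
    have dg := hg.differentiableAt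
    refine ⟨dg.mul dK, ?_⟩
    rw [fderiv_fun_mul dg dK, hg.fderiv]
    simp only [_root_.add_apply, _root_.smul_apply, smul_eq_mul, ContinuousLinearMap.coe_comp, comp_apply,
      ContinuousLinearMap.coe_id', id_eq, fK]
    ring

/-- The derivative of the truncated section is continuous in `y` (`η ∈ C³`). [folklore] -/
theorem continuous_fderiv_truncK1_section (hη : ContDiff ℝ 3 η) (hR : ∀ z : E3, R < ‖z‖ → η z = 0) (hε : 0 < ε)
    (i j a b : Fin 3) (x : E3) :
    Continuous fun y : E3 ↦ fderiv ℝ (radialCutoff ε (2 * ε)) (x - y) (e b) * bogovskiiK1 η y i j a (x - y) -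
      (1 - radialCutoff ε (2 * ε) (x - y)) * bogovskiiK2 η y i j a b (x - y) +
      (1 - radialCutoff ε (2 * ε) (x - y)) * bogovskiiK1 (pd b η) y i j a (x - y) := by
  have h2 : ContDiff ℝ 2 η := hη.of_le (by norm_cast)
  obtain ⟨hbη, hRb⟩ := contDiff_pd_and_vanish (n := 2) hη hR b
  have hθs : ContDiff ℝ 1 (radialCutoff ε (2 * ε) : E3 → ℝ) := radialCutoff_contDiff ε (2 * ε)
  have c1 : Continuous fun y : E3 ↦ fderiv ℝ (radialCutoff ε (2 * ε)) (x - y) (e b) :=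
    ((hθs.continuous_fderiv one_ne_zero).comp (continuous_const.sub continuous_id)).clm_apply continuous_const
  have c1z : ∀ y : E3, ‖x - y‖ < ε → fderiv ℝ (radialCutoff ε (2 * ε)) (x - y) (e b) = 0 := fun y hy ↦ by
    rw [Literature.Analysis.SingularIntegrals.fderiv_radialCutoff_eq_zero_of_lt hε.le (by linarith) hy,
      _root_.zero_apply]
  have c2 : Continuous fun y : E3 ↦ 1 - radialCutoff ε (2 * ε) (x - y) :=
    continuous_const.sub (hθs.continuous.comp (continuous_const.sub continuous_id))
  have c2z : ∀ y : E3, ‖x - y‖ < ε → 1 - radialCutoff ε (2 * ε) (x - y) = 0 := fun y hy ↦ by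
    rw [radialCutoff_eq_one hε.le (by linarith) hy.le, sub_self]
  have t1 := continuous_mul_of_eqOn_ball_pt c1 hε c1z (continuousOn_bogovskiiK1_section h2 hR i j a x)
  have t2 := continuous_mul_of_eqOn_ball_pt c2 hε c2z (c := x) (v := fun y ↦ bogovskiiK2 η y i j a b (x - y))
    fun y hy ↦ (continuousAt_bogovskiiK2_section hη hR i j a b x hy).continuousWithinAt
  have t3 := continuous_mul_of_eqOn_ball_pt c2 hε c2z (continuousOn_bogovskiiK1_section hbη hRb i j a x)
  exact (t1.sub t2).add t3

/-- The truncated section is continuous in `y` (`η ∈ C²`). [folklore] -/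
theorem continuous_truncK1_section (hη : ContDiff ℝ 2 η) (hR : ∀ z : E3, R < ‖z‖ → η z = 0) (hε : 0 < ε)
    (i j a : Fin 3) (x : E3) :
    Continuous fun y : E3 ↦ (1 - radialCutoff ε (2 * ε) (x - y)) * bogovskiiK1 η y i j a (x - y) := by
  have hθs : ContDiff ℝ 1 (radialCutoff ε (2 * ε) : E3 → ℝ) := radialCutoff_contDiff ε (2 * ε)
  have c2 : Continuous fun y : E3 ↦ 1 - radialCutoff ε (2 * ε) (x - y) :=
    continuous_const.sub (hθs.continuous.comp (continuous_const.sub continuous_id))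
  have c2z : ∀ y : E3, ‖x - y‖ < ε → 1 - radialCutoff ε (2 * ε) (x - y) = 0 := fun y hy ↦ by
    rw [radialCutoff_eq_one hε.le (by linarith) hy.le, sub_self]
  exact continuous_mul_of_eqOn_ball_pt c2 hε c2z (continuousOn_bogovskiiK1_section hη hR i j a x)

/-- **Integration by parts against the truncated section**: for `η ∈ C³`, `ε > 0` and `f ∈ C¹_c`,
`∫ (1 − θ_ε(x − y)) K₁[η](x − y; y) ∂_b f(y) dy = −∫ ∂_{y_b}[(1 − θ_ε(x − y)) K₁[η](x − y; y)] f(y) dy`.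
[cite: MaoOhTao2023, Lemma 2.3 (S3)] -/
theorem integral_truncK1_section_mul_pd (hη : ContDiff ℝ 3 η) (hR : ∀ z : E3, R < ‖z‖ → η z = 0) (hε : 0 < ε)
    {f : E3 → ℝ} (hf : ContDiff ℝ 1 f) (hfc : HasCompactSupport f) (i j a b : Fin 3) (x : E3) :
    ∫ y, (1 - radialCutoff ε (2 * ε) (x - y)) * bogovskiiK1 η y i j a (x - y) * pd b f y =
      -∫ y, (fderiv ℝ (radialCutoff ε (2 * ε)) (x - y) (e b) * bogovskiiK1 η y i j a (x - y) -
        (1 - radialCutoff ε (2 * ε) (x - y)) * bogovskiiK2 η y i j a b (x - y) +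
        (1 - radialCutoff ε (2 * ε) (x - y)) * bogovskiiK1 (pd b η) y i j a (x - y)) * f y := by
  have h2 : ContDiff ℝ 2 η := hη.of_le (by norm_cast)
  have hfcn : Continuous f := hf.continuous
  have hfd : Differentiable ℝ f := hf.differentiable one_ne_zero
  have hpdf : Continuous (pd b f) := by
    unfold pd; exact (hf.continuous_fderiv one_ne_zero).clm_apply continuous_const
  set u : E3 → ℝ := fun y ↦ (1 - radialCutoff ε (2 * ε) (x - y)) * bogovskiiK1 η y i j a (x - y) with hu
  have hud : ∀ y, DifferentiableAt ℝ u y := fun y ↦ (fderiv_truncK1_section_e h2 hR hε i j a b x y).1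
  have hfu : (fun y ↦ fderiv ℝ u y (e b)) = fun y ↦
      fderiv ℝ (radialCutoff ε (2 * ε)) (x - y) (e b) * bogovskiiK1 η y i j a (x - y) -
        (1 - radialCutoff ε (2 * ε) (x - y)) * bogovskiiK2 η y i j a b (x - y) +
        (1 - radialCutoff ε (2 * ε) (x - y)) * bogovskiiK1 (pd b η) y i j a (x - y) :=
    funext fun y ↦ (fderiv_truncK1_section_e h2 hR hε i j a b x y).2
  have huc : Continuous u := continuous_truncK1_section h2 hR hε i j a x
  have hfuc : Continuous fun y ↦ fderiv ℝ u y (e b) := by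
    rw [hfu]; exact continuous_fderiv_truncK1_section hη hR hε i j a b x
  have hI1 : Integrable fun y ↦ fderiv ℝ u y (e b) * f y :=
    (hfuc.mul hfcn).integrable_of_hasCompactSupport hfc.mul_left
  have hI2 : Integrable fun y ↦ u y * fderiv ℝ f y (e b) :=
    (huc.mul hpdf).integrable_of_hasCompactSupport (hasCompactSupport_pd hfc b).mul_left
  have hI3 : Integrable fun y ↦ u y * f y := (huc.mul hfcn).integrable_of_hasCompactSupport hfc.mul_left
  have hibp := integral_mul_fderiv_eq_neg_fderiv_mul_of_integrable hI1 hI2 hI3 (fun y _ ↦ hud y) fun y _ ↦ hfd y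
  have hlhs : (fun y ↦ (1 - radialCutoff ε (2 * ε) (x - y)) * bogovskiiK1 η y i j a (x - y) * pd b f y) =
      fun y ↦ u y * fderiv ℝ f y (e b) := rfl
  rw [hlhs, hibp]
  congr 1
  refine integral_congr_ae (ae_of_all _ fun y ↦ ?_)
  have := congrFun hfu y
  show fderiv ℝ u y (e b) * f y = _
  rw [this]

end TruncatedSection


section SchurConv

open scoped ENNReal

/-- **Schur's test for convolution majorants** (`L²`): if `‖F(x)‖ ≤ ∫ k(x − y) ‖f(y)‖ dy` pointwise with a measurable
`k ≥ 0`, then `∫ |F|² ≤ (∫ k)² ∫ |f|²` (`(∫k)^{2/2} · ∫k`). [folklore] -/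
theorem lintegral_sq_le_of_conv_majorant {k : E3 → ℝ≥0∞} (hk : Measurable k) {F f : E3 → ℝ} (hf : Measurable f)
    (hF : ∀ x, ‖F x‖ₑ ≤ ∫⁻ y, k (x - y) * ‖f y‖ₑ) :
    ∫⁻ x, ‖F x‖ₑ ^ (2 : ℝ) ≤ (∫⁻ z, k z) ^ ((2 : ℝ) / 2) * (∫⁻ z, k z) * ∫⁻ y, ‖f y‖ₑ ^ (2 : ℝ) := by
  set Ck : ℝ≥0∞ := ∫⁻ z, k z with hCk
  set K : E3 → E3 → ℝ≥0∞ := fun x y ↦ k (x - y) with hKdef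
  have hKm : Measurable (uncurry K) := hk.comp (measurable_fst.sub measurable_snd)
  have hrow : ∀ᵐ x ∂(volume : Measure E3), ∫⁻ y, K x y * (1 : ℝ≥0∞) ^ (2 : ℝ) ≤ Ck * (1 : ℝ≥0∞) ^ (2 : ℝ) := by
    refine ae_of_all _ fun x ↦ ?_
    simp only [ENNReal.one_rpow, mul_one]
    exact (lintegral_sub_left_eq_self k x).le
  have hcol : ∀ᵐ y ∂(volume : Measure E3), ∫⁻ x, K x y * (1 : ℝ≥0∞) ^ (2 : ℝ) ≤ Ck * (1 : ℝ≥0∞) ^ (2 : ℝ) := by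
    refine ae_of_all _ fun y ↦ ?_
    simp only [ENNReal.one_rpow, mul_one]
    exact (lintegral_sub_right_eq_self k y).le
  have hschur := Literature.Analysis.SingularIntegrals.lintegral_rpow_lintegral_le_of_schur
    (μ := (volume : Measure E3)) (ν := (volume : Measure E3)) (p := 2) (q := 2) Real.HolderConjugate.two_two hKm
    measurable_const measurable_const (ae_of_all _ fun _ ↦ one_ne_zero) (ae_of_all _ fun _ ↦ ENNReal.one_ne_top)
    hrow hcol (f := fun y ↦ ‖f y‖ₑ) hf.enorm
  refine le_trans (lintegral_mono fun x ↦ ?_) hschur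
  exact ENNReal.rpow_le_rpow (hF x) (by norm_num)

/-- **Pointwise majorant step**: if `|κ(x, y)| ≤ m(x − y)` whenever `g(y) ≠ 0`, then
`‖∫ κ(x, y) g(y) dy‖ₑ ≤ ∫⁻ ofReal(m(x − y)) ‖g(y)‖ₑ dy`. [folklore] -/
theorem enorm_integral_kernel_le {κ : E3 → E3 → ℝ} {m : E3 → ℝ} {g : E3 → ℝ} (x : E3)
    (hκ : ∀ y, g y ≠ 0 → |κ x y| ≤ m (x - y)) :
    ‖∫ y, κ x y * g y‖ₑ ≤ ∫⁻ y, ENNReal.ofReal (m (x - y)) * ‖g y‖ₑ := by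
  refine (enorm_integral_le_lintegral_enorm _).trans (lintegral_mono fun y ↦ ?_)
  rw [enorm_mul]
  by_cases hg : g y = 0
  · simp [hg]
  · gcongr
    rw [Real.enorm_eq_ofReal_abs]
    exact ENNReal.ofReal_le_ofReal (hκ y hg)

/-- The `ℝ≥0∞` majorant `1_{B_r} C/|z|²` has integral `ofReal (3 |B₁| C r)` for `C ≥ 0`, `r > 0`. [folklore] -/
theorem lintegral_ball_inv_sq_majorant {C r : ℝ} (hC : 0 ≤ C) (hr : 0 < r) :
    ∫⁻ z, ENNReal.ofReal ((ball (0 : E3) r).indicator (fun z ↦ C / ‖z‖ ^ 2) z) =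
      ENNReal.ofReal (3 * (volume : Measure E3).real (ball 0 1) * C * r) := by
  have h1 : (fun z : E3 ↦ ENNReal.ofReal ((ball (0 : E3) r).indicator (fun z ↦ C / ‖z‖ ^ 2) z)) =
      (ball (0 : E3) r).indicator fun z ↦ ENNReal.ofReal (C * ‖z‖ ^ (-(2 : ℝ))) := by
    funext z
    by_cases hz : z ∈ ball (0 : E3) r
    · rw [indicator_of_mem hz, indicator_of_mem hz, Real.rpow_neg (norm_nonneg _), div_eq_mul_inv]
      norm_num
    · rw [indicator_of_notMem hz, indicator_of_notMem hz, ENNReal.ofReal_zero]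
  rw [h1, lintegral_indicator measurableSet_ball]
  have h2 : ∫⁻ z in ball (0 : E3) r, ENNReal.ofReal (C * ‖z‖ ^ (-(2 : ℝ))) =
      ENNReal.ofReal C * ∫⁻ z in ball (0 : E3) r, ENNReal.ofReal (‖z‖ ^ (-(2 : ℝ))) := by
    rw [← lintegral_const_mul' _ _ ENNReal.ofReal_ne_top]
    refine lintegral_congr fun z ↦ ?_
    rw [ENNReal.ofReal_mul hC]
  rw [h2, Literature.Analysis.FluidPDE.NewtonPotentialHolder.lintegral_ball_norm_rpow_neg (by norm_num) hr,
    ← ENNReal.ofReal_mul hC]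
  congr 1
  have : (3 : ℝ) - 2 = 1 := by norm_num
  rw [this, Real.rpow_one, div_one]
  ring

/-- The shifted `ℝ≥0∞` majorant is measurable. [folklore] -/
theorem measurable_ofReal_ball_indicator (C r : ℝ) :
    Measurable fun z : E3 ↦ ENNReal.ofReal ((ball (0 : E3) r).indicator (fun z ↦ C / ‖z‖ ^ 2) z) :=
  ENNReal.measurable_ofReal.comp ((measurable_const.div (continuous_norm.measurable.pow_const 2)).indicator
    measurableSet_ball)

end SchurConv


section Decomposition

open scoped ENNReal

variable {η : E3 → ℝ} {R ε : ℝ}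

/-- The three continuous pieces of `∂_b u` (each a factor vanishing for `|x − y| < ε` times a section continuous off
`x`). [folklore] -/
theorem continuous_truncTerms (hη : ContDiff ℝ 3 η) (hR : ∀ z : E3, R < ‖z‖ → η z = 0) (hε : 0 < ε)
    (i j a b : Fin 3) (x : E3) :
    (Continuous fun y : E3 ↦ fderiv ℝ (radialCutoff ε (2 * ε)) (x - y) (e b) * bogovskiiK1 η y i j a (x - y)) ∧
    (Continuous fun y : E3 ↦ (1 - radialCutoff ε (2 * ε) (x - y)) * bogovskiiK2 η y i j a b (x - y)) ∧
    (Continuous fun y : E3 ↦ (1 - radialCutoff ε (2 * ε) (x - y)) * bogovskiiK1 (pd b η) y i j a (x - y)) := by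
  have h2 : ContDiff ℝ 2 η := hη.of_le (by norm_cast)
  obtain ⟨hbη, hRb⟩ := contDiff_pd_and_vanish (n := 2) hη hR b
  have hθs : ContDiff ℝ 1 (radialCutoff ε (2 * ε) : E3 → ℝ) := radialCutoff_contDiff ε (2 * ε)
  have c1 : Continuous fun y : E3 ↦ fderiv ℝ (radialCutoff ε (2 * ε)) (x - y) (e b) :=
    ((hθs.continuous_fderiv one_ne_zero).comp (continuous_const.sub continuous_id)).clm_apply continuous_const
  have c1z : ∀ y : E3, ‖x - y‖ < ε → fderiv ℝ (radialCutoff ε (2 * ε)) (x - y) (e b) = 0 := fun y hy ↦ by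
    rw [Literature.Analysis.SingularIntegrals.fderiv_radialCutoff_eq_zero_of_lt hε.le (by linarith) hy,
      _root_.zero_apply]
  have c2 : Continuous fun y : E3 ↦ 1 - radialCutoff ε (2 * ε) (x - y) :=
    continuous_const.sub (hθs.continuous.comp (continuous_const.sub continuous_id))
  have c2z : ∀ y : E3, ‖x - y‖ < ε → 1 - radialCutoff ε (2 * ε) (x - y) = 0 := fun y hy ↦ by
    rw [radialCutoff_eq_one hε.le (by linarith) hy.le, sub_self]
  exact ⟨continuous_mul_of_eqOn_ball_pt c1 hε c1z (continuousOn_bogovskiiK1_section h2 hR i j a x),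
    continuous_mul_of_eqOn_ball_pt c2 hε c2z (c := x) (v := fun y ↦ bogovskiiK2 η y i j a b (x - y))
      fun y hy ↦ (continuousAt_bogovskiiK2_section hη hR i j a b x hy).continuousWithinAt,
    continuous_mul_of_eqOn_ball_pt c2 hε c2z (continuousOn_bogovskiiK1_section hbη hRb i j a x)⟩

/-- **`F_ε = A_ε − B_ε − L_ε`**: the integration-by-parts integral split into the cutoff-derivative term `B_ε`, the
Calderón–Zygmund term `A_ε` and the lower-order term `L_ε`. [cite: MaoOhTao2023, Lemma 2.3 (S3)] -/
theorem integral_truncK1_section_mul_pd_eq (hη : ContDiff ℝ 3 η) (hR : ∀ z : E3, R < ‖z‖ → η z = 0) (hε : 0 < ε)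
    {f : E3 → ℝ} (hf : ContDiff ℝ 1 f) (hfc : HasCompactSupport f) (i j a b : Fin 3) (x : E3) :
    ∫ y, (1 - radialCutoff ε (2 * ε) (x - y)) * bogovskiiK1 η y i j a (x - y) * pd b f y =
      (∫ y, (1 - radialCutoff ε (2 * ε) (x - y)) * bogovskiiK2 η y i j a b (x - y) * f y) -
        (∫ y, fderiv ℝ (radialCutoff ε (2 * ε)) (x - y) (e b) * bogovskiiK1 η y i j a (x - y) * f y) -
        ∫ y, (1 - radialCutoff ε (2 * ε) (x - y)) * bogovskiiK1 (pd b η) y i j a (x - y) * f y := by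
  rw [integral_truncK1_section_mul_pd hη hR hε hf hfc i j a b x]
  obtain ⟨c1, c2, c3⟩ := continuous_truncTerms hη hR hε i j a b x
  have hfcn : Continuous f := hf.continuous
  have hI1 : Integrable fun y ↦ fderiv ℝ (radialCutoff ε (2 * ε)) (x - y) (e b) * bogovskiiK1 η y i j a (x - y) * f y :=
    (c1.mul hfcn).integrable_of_hasCompactSupport hfc.mul_left
  have hI2 : Integrable fun y ↦ (1 - radialCutoff ε (2 * ε) (x - y)) * bogovskiiK2 η y i j a b (x - y) * f y :=
    (c2.mul hfcn).integrable_of_hasCompactSupport hfc.mul_left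
  have hI3 : Integrable fun y ↦ (1 - radialCutoff ε (2 * ε) (x - y)) * bogovskiiK1 (pd b η) y i j a (x - y) * f y :=
    (c3.mul hfcn).integrable_of_hasCompactSupport hfc.mul_left
  have hsplit : (fun y ↦ (fderiv ℝ (radialCutoff ε (2 * ε)) (x - y) (e b) * bogovskiiK1 η y i j a (x - y) -
      (1 - radialCutoff ε (2 * ε) (x - y)) * bogovskiiK2 η y i j a b (x - y) +
      (1 - radialCutoff ε (2 * ε) (x - y)) * bogovskiiK1 (pd b η) y i j a (x - y)) * f y) =
      fun y ↦ (fderiv ℝ (radialCutoff ε (2 * ε)) (x - y) (e b) * bogovskiiK1 η y i j a (x - y) * f y -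
        (1 - radialCutoff ε (2 * ε) (x - y)) * bogovskiiK2 η y i j a b (x - y) * f y) +
        (1 - radialCutoff ε (2 * ε) (x - y)) * bogovskiiK1 (pd b η) y i j a (x - y) * f y := by
    funext y; ring
  have h12 : Integrable fun y ↦ fderiv ℝ (radialCutoff ε (2 * ε)) (x - y) (e b) * bogovskiiK1 η y i j a (x - y) * f y -
      (1 - radialCutoff ε (2 * ε) (x - y)) * bogovskiiK2 η y i j a b (x - y) * f y := hI1.sub hI2
  rw [hsplit, integral_add h12 hI3, integral_sub hI1 hI2]
  ring

/-- **Pointwise majorant of the `θ_ε K₁` integrand**: `|θ_ε(x − y) K₁(x − y; y) g(y)| ≤ m(x − y)·‖g‖_∞` with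
`m = 1_{B_{3ε}} A'/|z|²` (`|g| ≤ Mg`, `g` supported in `B̄_ρ`). [folklore] -/
theorem abs_thetaK1_le (hη : ContDiff ℝ 1 η) (hR : ∀ z : E3, R < ‖z‖ → η z = 0) {M : ℝ} (hM0 : ∀ w, |η w| ≤ M)
    (hM1 : ∀ a w, |pd a η w| ≤ M) (hε : 0 < ε) {ρ : ℝ} {g : E3 → ℝ} (hgρ : ∀ y, g y ≠ 0 → ‖y‖ ≤ ρ) (i j a : Fin 3)
    (x y : E3) (hy : g y ≠ 0) :
    |radialCutoff ε (2 * ε) (x - y) * bogovskiiK1 η y i j a (x - y)| ≤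
      (ball (0 : E3) (3 * ε)).indicator
        (fun z ↦ M * (4 * (max (R + ρ) 0) ^ 3 + 2 * (max (R + ρ) 0) ^ 4) / ‖z‖ ^ 2) (x - y) := by
  have hMnn : 0 ≤ M := (abs_nonneg _).trans (hM0 0)
  by_cases hz : 2 * ε < ‖x - y‖
  · rw [radialCutoff_eq_zero hε.le (by linarith) hz.le, zero_mul, abs_zero]
    exact indicator_nonneg (fun z _ ↦ by positivity) _
  · have hmem : x - y ∈ ball (0 : E3) (3 * ε) := by
      rw [mem_ball, dist_zero_right]; linarith
    rw [indicator_of_mem hmem, abs_mul]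
    calc _ ≤ 1 * (M * (4 * (max (R + ρ) 0) ^ 3 + 2 * (max (R + ρ) 0) ^ 4) / ‖x - y‖ ^ 2) :=
          mul_le_mul (abs_radialCutoff_le_one _ _ _) (abs_bogovskiiK1_le hη hR hM0 hM1 (hgρ y hy) i j a (x - y))
            (abs_nonneg _) zero_le_one
      _ = _ := one_mul _

/-- The real majorant `1_{B_r} C/|z|²` is integrable. [folklore] -/
theorem integrable_ball_inv_sq_majorant (C r : ℝ) :
    Integrable fun z : E3 ↦ (ball (0 : E3) r).indicator (fun z ↦ C / ‖z‖ ^ 2) z := by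
  rw [integrable_indicator_iff measurableSet_ball]
  have h := (Literature.Analysis.FluidPDE.NewtonPotentialHolder.integrableOn_ball_norm_rpow_neg (s := 2)
    (by norm_num) r).const_mul C
  refine h.congr (ae_of_all _ fun z ↦ ?_)
  simp only
  rw [Real.rpow_neg (norm_nonneg _), show (2 : ℝ) = ((2 : ℕ) : ℝ) by norm_num, Real.rpow_natCast, div_eq_mul_inv]

/-- Integrability of the `θ_ε K₁` integrand against a continuous density supported in `B̄_ρ` (`η ∈ C³`). [folklore] -/
theorem integrable_thetaK1_mul (hη : ContDiff ℝ 3 η) (hR : ∀ z : E3, R < ‖z‖ → η z = 0) (hε : 0 < ε) {ρ : ℝ}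
    {g : E3 → ℝ} (hg : Continuous g) (hgc : HasCompactSupport g) (hgρ : ∀ y, g y ≠ 0 → ‖y‖ ≤ ρ) (i j a : Fin 3)
    (x : E3) : Integrable fun y ↦ radialCutoff ε (2 * ε) (x - y) * bogovskiiK1 η y i j a (x - y) * g y := by
  have h1 : ContDiff ℝ 1 η := hη.of_le (by norm_cast)
  have h2 : ContDiff ℝ 2 η := hη.of_le (by norm_cast)
  obtain ⟨M, hM0, hM1, -, -⟩ := exists_bound_pd_le_three hη hR
  obtain ⟨Mg, hMg⟩ := hg.bounded_above_of_compact_support hgc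
  have hMg0 : 0 ≤ Mg := (norm_nonneg _).trans (hMg 0)
  set A' : ℝ := M * (4 * (max (R + ρ) 0) ^ 3 + 2 * (max (R + ρ) 0) ^ 4) with hA'
  set m : E3 → ℝ := (ball (0 : E3) (3 * ε)).indicator fun z ↦ A' / ‖z‖ ^ 2 with hm
  have hmi : Integrable fun y ↦ Mg * m (x - y) := ((integrable_ball_inv_sq_majorant A' (3 * ε)).comp_sub_left x).const_mul Mg
  have hθc : Continuous fun y : E3 ↦ radialCutoff ε (2 * ε) (x - y) :=
    (radialCutoff_contDiff (n := 0) ε (2 * ε)).continuous.comp (continuous_const.sub continuous_id)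
  have hmeas : AEStronglyMeasurable (fun y ↦ radialCutoff ε (2 * ε) (x - y) * bogovskiiK1 η y i j a (x - y) * g y)
      volume := by
    refine ((hθc.aestronglyMeasurable.mul ?_).mul hg.aestronglyMeasurable)
    exact aestronglyMeasurable_of_continuousOn_compl_singleton' (continuousOn_bogovskiiK1_section h2 hR i j a x)
  refine hmi.mono' hmeas (ae_of_all _ fun y ↦ ?_)
  have hMnn : 0 ≤ M := (abs_nonneg _).trans (hM0 0)
  have hm0 : 0 ≤ m (x - y) := indicator_nonneg (fun z _ ↦ by positivity) _
  by_cases hgy : g y = 0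
  · rw [hgy, mul_zero, norm_zero]; positivity
  · rw [Real.norm_eq_abs, abs_mul, mul_comm]
    refine mul_le_mul ?_ (abs_thetaK1_le h1 hR hM0 hM1 hε hgρ i j a x y hgy) (abs_nonneg _) hMg0
    exact (Real.norm_eq_abs _).symm.le.trans (hMg y)

/-- **`∂_a S_η(∂_b f) = N_ε + F_ε`**: split of the kernel `K₁` into `θ_εK₁` (near the diagonal) and `(1 − θ_ε)K₁`.
[cite: MaoOhTao2023, Lemma 2.3 (S3)] -/
theorem pd_bogovskiiS_pd_eq_add (hη : ContDiff ℝ 3 η) (hR : ∀ z : E3, R < ‖z‖ → η z = 0) (hε : 0 < ε) {ρ : ℝ}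
    {f : E3 → ℝ} (hf : ContDiff ℝ 2 f) (hfc : HasCompactSupport f) (hfρ : ∀ y, f y ≠ 0 → ‖y‖ ≤ ρ) (i j a b : Fin 3)
    (x : E3) :
    pd a (bogovskiiS η (pd b f) i j) x =
      (∫ y, radialCutoff ε (2 * ε) (x - y) * bogovskiiK1 η y i j a (x - y) * pd b f y) +
        ∫ y, (1 - radialCutoff ε (2 * ε) (x - y)) * bogovskiiK1 η y i j a (x - y) * pd b f y := by
  have h1 : ContDiff ℝ 1 η := hη.of_le (by norm_cast)
  have h2 : ContDiff ℝ 2 η := hη.of_le (by norm_cast)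
  have hpf : ContDiff ℝ 1 (pd b f) := contDiff_pd (n := 1) hf b
  have hpfc : HasCompactSupport (pd b f) := hasCompactSupport_pd hfc b
  have hpfρ : ∀ y, pd b f y ≠ 0 → ‖y‖ ≤ ρ := by
    intro y hy
    by_contra h
    exact hy (pd_eq_zero_of_norm_lt (fun z hz ↦ by by_contra h'; exact (not_le.2 hz) (hfρ z h')) b y (not_le.1 h))
  rw [pd_bogovskiiS_eq_integral_bogovskiiK1 h1 hR hpf hpfc i j a x]
  have hN := integrable_thetaK1_mul hη hR hε hpf.continuous hpfc hpfρ i j a x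
  have hF : Integrable fun y ↦ (1 - radialCutoff ε (2 * ε) (x - y)) * bogovskiiK1 η y i j a (x - y) * pd b f y :=
    ((continuous_truncK1_section h2 hR hε i j a x).mul (hpf.continuous)).integrable_of_hasCompactSupport hpfc.mul_left
  rw [← integral_add hN hF]
  refine integral_congr_ae (ae_of_all _ fun y ↦ ?_)
  ring

/-- **Freezing the base point at the output point**: with `ζ = 1_{B̄_{D_x}}`, `D_x = max (R + 2ρ) ρ`,
`A_ε(x) = ζ(x) (T_ε[η](x, x) + E_ε(x))`, where `T_ε[η](x, x) = ∫ (1 − θ_ε(t)) K₂[η](t; x) f(x − t) dt` is the diagonal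
of the frozen operator and `E_ε` carries the kernel difference `K₂(x − y; y) − K₂(x − y; x)`.
[cite: MaoOhTao2023, Lemma 2.3 (S3)] -/
theorem czTerm_eq_frozen_add (hη : ContDiff ℝ 3 η) (hR : ∀ z : E3, R < ‖z‖ → η z = 0) (hε : 0 < ε) {ρ : ℝ}
    {f : E3 → ℝ} (hf : Continuous f) (hfc : HasCompactSupport f) (hfρ : ∀ y, f y ≠ 0 → ‖y‖ ≤ ρ) (i j a b : Fin 3)
    (x : E3) :
    ∫ y, (1 - radialCutoff ε (2 * ε) (x - y)) * bogovskiiK2 η y i j a b (x - y) * f y =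
      (closedBall (0 : E3) (max (R + 2 * ρ) ρ)).indicator (fun _ ↦ (1 : ℝ)) x *
        ((∫ t, (1 - radialCutoff ε (2 * ε) t) * bogovskiiK2 η x i j a b t * f (x - t)) +
          ∫ y, (1 - radialCutoff ε (2 * ε) (x - y)) *
            (bogovskiiK2 η y i j a b (x - y) - bogovskiiK2 η x i j a b (x - y)) * f y) := by
  by_cases hx : x ∈ closedBall (0 : E3) (max (R + 2 * ρ) ρ)
  · rw [indicator_of_mem hx, one_mul]
    have hfr : Continuous fun y : E3 ↦ (1 - radialCutoff ε (2 * ε) (x - y)) * bogovskiiK2 η x i j a b (x - y) :=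
      (continuous_truncK2 hη hR hε i j a b x).comp (continuous_const.sub continuous_id)
    obtain ⟨-, c2, -⟩ := continuous_truncTerms hη hR hε i j a b x
    have hI1 : Integrable fun y ↦ (1 - radialCutoff ε (2 * ε) (x - y)) * bogovskiiK2 η x i j a b (x - y) * f y :=
      (hfr.mul hf).integrable_of_hasCompactSupport hfc.mul_left
    have hI2 : Integrable fun y ↦ (1 - radialCutoff ε (2 * ε) (x - y)) *
        (bogovskiiK2 η y i j a b (x - y) - bogovskiiK2 η x i j a b (x - y)) * f y := by
      have : (fun y ↦ (1 - radialCutoff ε (2 * ε) (x - y)) *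
          (bogovskiiK2 η y i j a b (x - y) - bogovskiiK2 η x i j a b (x - y)) * f y) =
          fun y ↦ (1 - radialCutoff ε (2 * ε) (x - y)) * bogovskiiK2 η y i j a b (x - y) * f y -
            (1 - radialCutoff ε (2 * ε) (x - y)) * bogovskiiK2 η x i j a b (x - y) * f y := by
        funext y; ring
      rw [this]
      exact ((c2.mul hf).integrable_of_hasCompactSupport hfc.mul_left).sub hI1
    have hsub : (∫ t, (1 - radialCutoff ε (2 * ε) t) * bogovskiiK2 η x i j a b t * f (x - t)) =
        ∫ y, (1 - radialCutoff ε (2 * ε) (x - y)) * bogovskiiK2 η x i j a b (x - y) * f y := by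
      rw [← integral_sub_left_eq_self (fun t ↦ (1 - radialCutoff ε (2 * ε) t) * bogovskiiK2 η x i j a b t * f (x - t))
        volume x]
      refine integral_congr_ae (ae_of_all _ fun y ↦ ?_)
      simp only [sub_sub_cancel]
    rw [hsub, ← integral_add hI1 hI2]
    refine integral_congr_ae (ae_of_all _ fun y ↦ ?_)
    ring
  · rw [indicator_of_notMem hx, zero_mul]
    refine integral_eq_zero_of_ae (ae_of_all _ fun y ↦ ?_)
    by_cases hfy : f y = 0
    · simp [hfy]
    · have hyρ := hfρ y hfy
      rw [mem_closedBall, dist_zero_right, not_le, max_lt_iff] at hx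
      have hz : max (R + ‖y‖) 0 < ‖x - y‖ := by
        have h1 : ‖x‖ - ‖y‖ ≤ ‖x - y‖ := norm_sub_norm_le x y
        rw [max_lt_iff]
        constructor <;> linarith
      show (1 - radialCutoff ε (2 * ε) (x - y)) * bogovskiiK2 η y i j a b (x - y) * f y = 0
      rw [bogovskiiK2_eq_zero_of_lt hR y i j a b hz, mul_zero, zero_mul]

end Decomposition


section SchurBounds

open scoped ENNReal

variable {η : E3 → ℝ} {R ε : ℝ}

/-- Constant indicator majorant: `∫⁻ ofReal(1_{B_r} c) = ofReal (c r³ |B₁|)` (`c ≥ 0`, `r ≥ 0`). [folklore] -/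
theorem lintegral_ball_const_majorant {c r : ℝ} (hc : 0 ≤ c) (hr : 0 ≤ r) :
    ∫⁻ z, ENNReal.ofReal ((ball (0 : E3) r).indicator (fun _ ↦ c) z) =
      ENNReal.ofReal (c * (r ^ 3 * (volume : Measure E3).real (ball 0 1))) := by
  have h1 : (fun z : E3 ↦ ENNReal.ofReal ((ball (0 : E3) r).indicator (fun _ ↦ c) z)) =
      (ball (0 : E3) r).indicator fun _ ↦ ENNReal.ofReal c := by
    funext z
    by_cases hz : z ∈ ball (0 : E3) r
    · rw [indicator_of_mem hz, indicator_of_mem hz]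
    · rw [indicator_of_notMem hz, indicator_of_notMem hz, ENNReal.ofReal_zero]
  rw [h1, lintegral_indicator measurableSet_ball, setLIntegral_const, Measure.addHaar_ball _ _ hr,
    finrank_euclideanSpace_fin, ENNReal.ofReal_mul hc, ENNReal.ofReal_mul (by positivity), measureReal_def,
    ENNReal.ofReal_toReal measure_ball_lt_top.ne]

/-- **Bound for `N_ε`** (the near-diagonal part, small with `ε`): `∫ |N_ε|² ≤ (∫ m_N)² ∫ |g|²` with
`m_N = 1_{B_{3ε}} A'/|z|²`, `∫ m_N = 9|B₁|A'ε`. [cite: MaoOhTao2023, Lemma 2.3 (S3)] -/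
theorem lintegral_sq_thetaK1_le (hη : ContDiff ℝ 1 η) (hR : ∀ z : E3, R < ‖z‖ → η z = 0) {M : ℝ}
    (hM0 : ∀ w, |η w| ≤ M) (hM1 : ∀ a w, |pd a η w| ≤ M) (hε : 0 < ε) {ρ : ℝ} {g : E3 → ℝ} (hgm : Measurable g)
    (hgρ : ∀ y, g y ≠ 0 → ‖y‖ ≤ ρ) (i j a : Fin 3) :
    ∫⁻ x, ‖∫ y, radialCutoff ε (2 * ε) (x - y) * bogovskiiK1 η y i j a (x - y) * g y‖ₑ ^ (2 : ℝ) ≤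
      ENNReal.ofReal (3 * (volume : Measure E3).real (ball 0 1) *
          (M * (4 * (max (R + ρ) 0) ^ 3 + 2 * (max (R + ρ) 0) ^ 4)) * (3 * ε)) ^ ((2 : ℝ) / 2) *
        ENNReal.ofReal (3 * (volume : Measure E3).real (ball 0 1) *
          (M * (4 * (max (R + ρ) 0) ^ 3 + 2 * (max (R + ρ) 0) ^ 4)) * (3 * ε)) *
        ∫⁻ y, ‖g y‖ₑ ^ (2 : ℝ) := by
  have hMnn : 0 ≤ M := (abs_nonneg _).trans (hM0 0)
  set A' : ℝ := M * (4 * (max (R + ρ) 0) ^ 3 + 2 * (max (R + ρ) 0) ^ 4) with hA'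
  have hA'0 : 0 ≤ A' := by positivity
  set m : E3 → ℝ := (ball (0 : E3) (3 * ε)).indicator fun z ↦ A' / ‖z‖ ^ 2 with hm
  have hk := measurable_ofReal_ball_indicator A' (3 * ε)
  have hCk : ∫⁻ z, ENNReal.ofReal (m z) = ENNReal.ofReal (3 * (volume : Measure E3).real (ball 0 1) * A' * (3 * ε)) :=
    lintegral_ball_inv_sq_majorant hA'0 (by positivity)
  have h := lintegral_sq_le_of_conv_majorant hk hgm
    (F := fun x ↦ ∫ y, radialCutoff ε (2 * ε) (x - y) * bogovskiiK1 η y i j a (x - y) * g y)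
    (fun x ↦ enorm_integral_kernel_le (κ := fun x y ↦ radialCutoff ε (2 * ε) (x - y) * bogovskiiK1 η y i j a (x - y))
      x (fun y hy ↦ abs_thetaK1_le hη hR hM0 hM1 hε hgρ i j a x y hy))
  rwa [hCk] at h

/-- **Bound for `B_ε`** (the cutoff-derivative term): `∫ |B_ε|² ≤ (∫ m_B)² ∫ |g|²` with the constant majorant
`m_B = 1_{B_{3ε}} B ε⁻¹ A' ε⁻²`, `∫ m_B = 27 B A' |B₁|` (uniform in `ε`). [cite: MaoOhTao2023, Lemma 2.3 (S3)] -/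
theorem lintegral_sq_dthetaK1_le (hη : ContDiff ℝ 1 η) (hR : ∀ z : E3, R < ‖z‖ → η z = 0) {M : ℝ}
    (hM0 : ∀ w, |η w| ≤ M) (hM1 : ∀ a w, |pd a η w| ≤ M) {B : ℝ} (hB0 : 0 ≤ B)
    (hB : ∀ ε : ℝ, 0 < ε → ∀ z : E3, ‖fderiv ℝ (radialCutoff ε (2 * ε)) z‖ ≤ B * ε⁻¹) (hε : 0 < ε) {ρ : ℝ}
    {g : E3 → ℝ} (hgm : Measurable g) (hgρ : ∀ y, g y ≠ 0 → ‖y‖ ≤ ρ) (i j a b : Fin 3) :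
    ∫⁻ x, ‖∫ y, fderiv ℝ (radialCutoff ε (2 * ε)) (x - y) (e b) * bogovskiiK1 η y i j a (x - y) * g y‖ₑ ^ (2 : ℝ) ≤
      ENNReal.ofReal (B * (M * (4 * (max (R + ρ) 0) ^ 3 + 2 * (max (R + ρ) 0) ^ 4)) *
          (27 * (volume : Measure E3).real (ball 0 1))) ^ ((2 : ℝ) / 2) *
        ENNReal.ofReal (B * (M * (4 * (max (R + ρ) 0) ^ 3 + 2 * (max (R + ρ) 0) ^ 4)) *
          (27 * (volume : Measure E3).real (ball 0 1))) *
        ∫⁻ y, ‖g y‖ₑ ^ (2 : ℝ) := by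
  have hMnn : 0 ≤ M := (abs_nonneg _).trans (hM0 0)
  set A' : ℝ := M * (4 * (max (R + ρ) 0) ^ 3 + 2 * (max (R + ρ) 0) ^ 4) with hA'
  have hA'0 : 0 ≤ A' := by positivity
  set c : ℝ := B * ε⁻¹ * (A' / ε ^ 2) with hc
  have hc0 : 0 ≤ c := by positivity
  set m : E3 → ℝ := (ball (0 : E3) (3 * ε)).indicator fun _ ↦ c with hm
  have hk : Measurable fun z : E3 ↦ ENNReal.ofReal (m z) :=
    ENNReal.measurable_ofReal.comp (measurable_const.indicator measurableSet_ball)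
  have hCk : ∫⁻ z, ENNReal.ofReal (m z) = ENNReal.ofReal (B * A' * (27 * (volume : Measure E3).real (ball 0 1))) := by
    rw [hm, lintegral_ball_const_majorant hc0 (by positivity)]
    congr 1
    rw [hc]; field_simp; ring
  have hpt : ∀ x y, g y ≠ 0 →
      |fderiv ℝ (radialCutoff ε (2 * ε)) (x - y) (e b) * bogovskiiK1 η y i j a (x - y)| ≤ m (x - y) := by
    intro x y hy
    set z := x - y with hz
    have h1 : |fderiv ℝ (radialCutoff ε (2 * ε)) z (e b)| ≤
        (closedBall (0 : E3) (2 * ε) \ ball 0 ε).indicator (fun _ ↦ B * ε⁻¹) z := by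
      have := Literature.Analysis.SingularIntegrals.norm_fderiv_radialCutoff_eps_le_indicator hB hε z
      refine le_trans ?_ this
      rw [← Real.norm_eq_abs]
      calc ‖fderiv ℝ (radialCutoff ε (2 * ε)) z (e b)‖ ≤ ‖fderiv ℝ (radialCutoff ε (2 * ε)) z‖ * ‖e b‖ :=
            ContinuousLinearMap.le_opNorm _ _
        _ ≤ ‖fderiv ℝ (radialCutoff ε (2 * ε)) z‖ * 1 := by
            gcongr; simp [e]
        _ = _ := mul_one _
    by_cases hmem : z ∈ closedBall (0 : E3) (2 * ε) \ ball 0 ε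
    · rw [indicator_of_mem hmem] at h1
      have hzε : ε ≤ ‖z‖ := by simpa using hmem.2
      have hz2 : ‖z‖ ≤ 2 * ε := by simpa using hmem.1
      have hzb : z ∈ ball (0 : E3) (3 * ε) := by rw [mem_ball, dist_zero_right]; linarith
      rw [hm, indicator_of_mem hzb, abs_mul]
      calc _ ≤ B * ε⁻¹ * (A' / ‖z‖ ^ 2) :=
            mul_le_mul h1 (abs_bogovskiiK1_le hη hR hM0 hM1 (hgρ y hy) i j a z) (abs_nonneg _) (by positivity)
        _ ≤ B * ε⁻¹ * (A' / ε ^ 2) := by gcongr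
    · rw [indicator_of_notMem hmem] at h1
      have h0 : fderiv ℝ (radialCutoff ε (2 * ε)) z (e b) = 0 := abs_nonpos_iff.1 h1
      rw [h0, zero_mul, abs_zero]
      exact indicator_nonneg (fun _ _ ↦ hc0) _
  have h := lintegral_sq_le_of_conv_majorant hk hgm
    (F := fun x ↦ ∫ y, fderiv ℝ (radialCutoff ε (2 * ε)) (x - y) (e b) * bogovskiiK1 η y i j a (x - y) * g y)
    (fun x ↦ enorm_integral_kernel_le
      (κ := fun x y ↦ fderiv ℝ (radialCutoff ε (2 * ε)) (x - y) (e b) * bogovskiiK1 η y i j a (x - y)) x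
      (fun y hy ↦ hpt x y hy))
  rwa [hCk] at h

/-- **Bound for `L_ε`** (lower order, `η` differentiated once): `∫ |L_ε|² ≤ (∫ m_L)² ∫ |g|²`,
`m_L = 1_{B_{D'+1}} A'/|z|²`, `D' = (R + ρ)₊`. [cite: MaoOhTao2023, Lemma 2.3 (S3)] -/
theorem lintegral_sq_truncK1pd_le (hη : ContDiff ℝ 2 η) (hR : ∀ z : E3, R < ‖z‖ → η z = 0) {M : ℝ}
    (hM1 : ∀ a w, |pd a η w| ≤ M) (hM2 : ∀ a b w, |pd a (pd b η) w| ≤ M) (ε : ℝ) {ρ : ℝ} {g : E3 → ℝ}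
    (hgm : Measurable g) (hgρ : ∀ y, g y ≠ 0 → ‖y‖ ≤ ρ) (i j a b : Fin 3) :
    ∫⁻ x, ‖∫ y, (1 - radialCutoff ε (2 * ε) (x - y)) * bogovskiiK1 (pd b η) y i j a (x - y) * g y‖ₑ ^ (2 : ℝ) ≤
      ENNReal.ofReal (3 * (volume : Measure E3).real (ball 0 1) *
          (M * (4 * (max (R + ρ) 0) ^ 3 + 2 * (max (R + ρ) 0) ^ 4)) * (max (R + ρ) 0 + 1)) ^ ((2 : ℝ) / 2) *
        ENNReal.ofReal (3 * (volume : Measure E3).real (ball 0 1) *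
          (M * (4 * (max (R + ρ) 0) ^ 3 + 2 * (max (R + ρ) 0) ^ 4)) * (max (R + ρ) 0 + 1)) *
        ∫⁻ y, ‖g y‖ₑ ^ (2 : ℝ) := by
  obtain ⟨hbη, hRb⟩ := contDiff_pd_and_vanish (n := 1) hη hR b
  have hMnn : 0 ≤ M := (abs_nonneg _).trans (hM1 0 0)
  set D' : ℝ := max (R + ρ) 0 with hD'
  have hD'0 : 0 ≤ D' := le_max_right _ _
  set A' : ℝ := M * (4 * D' ^ 3 + 2 * D' ^ 4) with hA'
  have hA'0 : 0 ≤ A' := by positivity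
  set m : E3 → ℝ := (ball (0 : E3) (D' + 1)).indicator fun z ↦ A' / ‖z‖ ^ 2 with hm
  have hk := measurable_ofReal_ball_indicator A' (D' + 1)
  have hCk : ∫⁻ z, ENNReal.ofReal (m z) = ENNReal.ofReal (3 * (volume : Measure E3).real (ball 0 1) * A' * (D' + 1)) :=
    lintegral_ball_inv_sq_majorant hA'0 (by positivity)
  have hpt : ∀ x y, g y ≠ 0 →
      |(1 - radialCutoff ε (2 * ε) (x - y)) * bogovskiiK1 (pd b η) y i j a (x - y)| ≤ m (x - y) := by
    intro x y hy
    set z := x - y with hz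
    by_cases hzb : z ∈ ball (0 : E3) (D' + 1)
    · rw [hm, indicator_of_mem hzb, abs_mul]
      calc _ ≤ 1 * (A' / ‖z‖ ^ 2) :=
            mul_le_mul (Literature.Analysis.SingularIntegrals.abs_one_sub_radialCutoff_le ε z)
              (abs_bogovskiiK1_le hbη hRb (hM1 b) (fun c w ↦ hM2 c b w) (hgρ y hy) i j a z) (abs_nonneg _)
              zero_le_one
        _ = _ := one_mul _
    · rw [hm, indicator_of_notMem hzb]
      rw [mem_ball, dist_zero_right, not_lt] at hzb
      have hvan : max (R + ‖y‖) 0 < ‖z‖ := by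
        calc max (R + ‖y‖) 0 ≤ D' := max_le_max (by linarith [hgρ y hy]) le_rfl
          _ < ‖z‖ := by linarith
      rw [bogovskiiK1_eq_zero_of_lt hRb y i j a hvan, mul_zero, abs_zero]
  have h := lintegral_sq_le_of_conv_majorant hk hgm
    (F := fun x ↦ ∫ y, (1 - radialCutoff ε (2 * ε) (x - y)) * bogovskiiK1 (pd b η) y i j a (x - y) * g y)
    (fun x ↦ enorm_integral_kernel_le
      (κ := fun x y ↦ (1 - radialCutoff ε (2 * ε) (x - y)) * bogovskiiK1 (pd b η) y i j a (x - y)) x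
      (fun y hy ↦ hpt x y hy))
  rwa [hCk] at h

/-- **Bound for the freezing error `E_ε`**: on `|x| ≤ D_x` the kernel difference
`|K₂(x − y; y) − K₂(x − y; x)| ≤ 3M|x − y|(4D̃³ + 8D̃⁴ + 2D̃⁵)/|x − y|³` is a kernel of degree `−2`, so
`∫ |1_{B̄_{D_x}} E_ε|² ≤ (∫ m_E)² ∫ |g|²`. [cite: MaoOhTao2023, Lemma 2.3 (S3)] -/
theorem lintegral_sq_freezeError_le (hη : ContDiff ℝ 3 η) (hR : ∀ z : E3, R < ‖z‖ → η z = 0) {M : ℝ}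
    (hM1 : ∀ a w, |pd a η w| ≤ M) (hM2 : ∀ a b w, |pd a (pd b η) w| ≤ M) (hM3 : ∀ a b c w, |pd a (pd b (pd c η)) w| ≤ M)
    (ε : ℝ) {ρ Dx : ℝ} {g : E3 → ℝ} (hgm : Measurable g) (hgρ : ∀ y, g y ≠ 0 → ‖y‖ ≤ ρ) (i j a b : Fin 3) :
    ∫⁻ x, ‖(closedBall (0 : E3) Dx).indicator (fun _ ↦ (1 : ℝ)) x *
        ∫ y, (1 - radialCutoff ε (2 * ε) (x - y)) *
          (bogovskiiK2 η y i j a b (x - y) - bogovskiiK2 η x i j a b (x - y)) * g y‖ₑ ^ (2 : ℝ) ≤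
      ENNReal.ofReal (3 * (volume : Measure E3).real (ball 0 1) *
          (3 * M * (4 * (max (R + max ρ Dx) 0) ^ 3 + 8 * (max (R + max ρ Dx) 0) ^ 4 +
            2 * (max (R + max ρ Dx) 0) ^ 5)) * (|Dx| + |ρ| + 1)) ^ ((2 : ℝ) / 2) *
        ENNReal.ofReal (3 * (volume : Measure E3).real (ball 0 1) *
          (3 * M * (4 * (max (R + max ρ Dx) 0) ^ 3 + 8 * (max (R + max ρ Dx) 0) ^ 4 +
            2 * (max (R + max ρ Dx) 0) ^ 5)) * (|Dx| + |ρ| + 1)) *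
        ∫⁻ y, ‖g y‖ₑ ^ (2 : ℝ) := by
  have hMnn : 0 ≤ M := (abs_nonneg _).trans (hM1 0 0)
  set ρt : ℝ := max ρ Dx with hρt
  set Dt : ℝ := max (R + ρt) 0 with hDt
  have hDt0 : 0 ≤ Dt := le_max_right _ _
  set C : ℝ := 3 * M * (4 * Dt ^ 3 + 8 * Dt ^ 4 + 2 * Dt ^ 5) with hC
  have hC0 : 0 ≤ C := by positivity
  set RE : ℝ := |Dx| + |ρ| + 1 with hRE
  have hRE0 : 0 < RE := by positivity
  set m : E3 → ℝ := (ball (0 : E3) RE).indicator fun z ↦ C / ‖z‖ ^ 2 with hm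
  have hk := measurable_ofReal_ball_indicator C RE
  have hCk : ∫⁻ z, ENNReal.ofReal (m z) = ENNReal.ofReal (3 * (volume : Measure E3).real (ball 0 1) * C * RE) :=
    lintegral_ball_inv_sq_majorant hC0 hRE0
  set ζ : E3 → ℝ := (closedBall (0 : E3) Dx).indicator fun _ ↦ (1 : ℝ) with hζ
  -- rewrite `ζ(x) ∫ … = ∫ ζ(x) …`
  have hF : ∀ x, ζ x * ∫ y, (1 - radialCutoff ε (2 * ε) (x - y)) *
      (bogovskiiK2 η y i j a b (x - y) - bogovskiiK2 η x i j a b (x - y)) * g y =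
      ∫ y, (ζ x * ((1 - radialCutoff ε (2 * ε) (x - y)) *
        (bogovskiiK2 η y i j a b (x - y) - bogovskiiK2 η x i j a b (x - y)))) * g y := by
    intro x
    rw [← integral_const_mul]
    refine integral_congr_ae (ae_of_all _ fun y ↦ ?_)
    ring
  have hpt : ∀ x y, g y ≠ 0 → |ζ x * ((1 - radialCutoff ε (2 * ε) (x - y)) *
      (bogovskiiK2 η y i j a b (x - y) - bogovskiiK2 η x i j a b (x - y)))| ≤ m (x - y) := by
    intro x y hy
    have hm0 : 0 ≤ m (x - y) := indicator_nonneg (fun z _ ↦ by positivity) _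
    by_cases hx : x ∈ closedBall (0 : E3) Dx
    · rw [hζ, indicator_of_mem hx, one_mul]
      have hxn : ‖x‖ ≤ Dx := by simpa using hx
      have hyn : ‖y‖ ≤ ρ := hgρ y hy
      set z := x - y with hz
      by_cases hz0 : z = 0
      · have hxy : y = x := by rw [hz, sub_eq_zero] at hz0; exact hz0.symm
        rw [hxy, sub_self, mul_zero, abs_zero]; exact hz ▸ hm0
      · have hzn : 0 < ‖z‖ := norm_pos_iff.2 hz0
        have hzRE : z ∈ ball (0 : E3) RE := by
          rw [mem_ball, dist_zero_right]
          calc ‖z‖ ≤ ‖x‖ + ‖y‖ := norm_sub_le x y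
            _ ≤ |Dx| + |ρ| := add_le_add (hxn.trans (le_abs_self _)) (hyn.trans (le_abs_self _))
            _ < RE := by rw [hRE]; linarith
        rw [hm, indicator_of_mem hzRE, abs_mul]
        have hdiff := abs_bogovskiiK2_sub_le hη hR hM1 hM2 hM3 (ρ := ρt) (y₁ := y) (y₂ := x)
          (hyn.trans (le_max_left _ _)) (hxn.trans (le_max_right _ _)) i j a b hz0
        have hyx : ‖y - x‖ = ‖z‖ := by rw [hz, ← norm_neg, neg_sub]
        rw [hyx] at hdiff
        calc _ ≤ 1 * (3 * M * ‖z‖ * (4 * Dt ^ 3 + 8 * Dt ^ 4 + 2 * Dt ^ 5) / ‖z‖ ^ 3) :=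
              mul_le_mul (Literature.Analysis.SingularIntegrals.abs_one_sub_radialCutoff_le ε z) hdiff (abs_nonneg _)
                zero_le_one
          _ = C / ‖z‖ ^ 2 := by rw [one_mul, hC]; field_simp
    · rw [hζ, indicator_of_notMem hx, zero_mul, abs_zero]; exact hm0
  have h := lintegral_sq_le_of_conv_majorant hk hgm
    (F := fun x ↦ ζ x * ∫ y, (1 - radialCutoff ε (2 * ε) (x - y)) *
      (bogovskiiK2 η y i j a b (x - y) - bogovskiiK2 η x i j a b (x - y)) * g y)
    (fun x ↦ by
      rw [hF x]
      exact enorm_integral_kernel_le (κ := fun x y ↦ ζ x * ((1 - radialCutoff ε (2 * ε) (x - y)) *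
        (bogovskiiK2 η y i j a b (x - y) - bogovskiiK2 η x i j a b (x - y)))) x (fun y hy ↦ hpt x y hy))
  rwa [hCk] at h

end SchurBounds


section MainEstimate

open scoped ENNReal

variable {η : E3 → ℝ} {R : ℝ}

/-- `(a + b + c + d + e)² ≤ 5(a² + b² + c² + d² + e²)` in `ℝ≥0∞`. [folklore] -/
theorem enorm_sum_five_sq_le (a b c d e' : ℝ≥0∞) :
    (a + b + c + d + e') ^ (2 : ℝ) ≤ 5 * (a ^ (2 : ℝ) + b ^ (2 : ℝ) + c ^ (2 : ℝ) + d ^ (2 : ℝ) + e' ^ (2 : ℝ)) := by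
  have h := ENNReal.rpow_sum_le_const_mul_sum_rpow Finset.univ ![a, b, c, d, e'] (p := 2) (by norm_num)
  simp only [Fin.sum_univ_five, Finset.card_univ, Fintype.card_fin, Matrix.cons_val_zero, Matrix.cons_val_one,
    Matrix.cons_val] at h
  norm_num at h
  convert h using 2 <;> norm_num

/-- The support of a partial derivative of `f` lies in the support ball of `f`. [folklore] -/
theorem norm_le_of_pd_ne_zero {f : E3 → ℝ} {ρ : ℝ} (hfρ : ∀ y, f y ≠ 0 → ‖y‖ ≤ ρ) (b : Fin 3) (y : E3)
    (hy : pd b f y ≠ 0) : ‖y‖ ≤ ρ := by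
  by_contra h
  exact hy (pd_eq_zero_of_norm_lt (fun z hz ↦ by by_contra h'; exact (not_le.2 hz) (hfρ z h')) b y (not_le.1 h))

/-- **Measurability of the `K₁`-type operators** `x ↦ ∫ φ(x − y) K₁[ψ](x − y; y) g(y) dy` (`φ, g` continuous,
`ψ ∈ C¹`). [folklore] -/
theorem measurable_K1op {φ ψ g : E3 → ℝ} (hφ : Continuous φ) (hψ : ContDiff ℝ 1 ψ) (hg : Continuous g)
    (i j a : Fin 3) : Measurable fun x : E3 ↦ ∫ y, φ (x - y) * bogovskiiK1 ψ y i j a (x - y) * g y := by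
  have hK := measurable_bogovskiiK1_uncurry hψ i j a
  have m1 : Measurable fun q : E3 × E3 ↦ φ (q.1 - q.2) := hφ.measurable.comp (measurable_fst.sub measurable_snd)
  have mi : Measurable fun q : E3 × E3 ↦ (q.1 - q.2, q.2) := (measurable_fst.sub measurable_snd).prodMk measurable_snd
  have m2 : Measurable fun q : E3 × E3 ↦ bogovskiiK1 ψ q.2 i j a (q.1 - q.2) := (hK.comp mi :)
  have m3 : Measurable fun q : E3 × E3 ↦ g q.2 := hg.measurable.comp measurable_snd
  have hF : Measurable fun q : E3 × E3 ↦ φ (q.1 - q.2) * bogovskiiK1 ψ q.2 i j a (q.1 - q.2) * g q.2 := (m1.mul m2).mul m3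
  have hS : StronglyMeasurable (uncurry fun (x y : E3) ↦ φ (x - y) * bogovskiiK1 ψ y i j a (x - y) * g y) :=
    (hF.stronglyMeasurable :)
  exact ((hS.integral_prod_right (ν := (volume : Measure E3))).measurable :)

/-- `∫ |∂_b f|² < ∞` for `f ∈ C¹_c`. [folklore] -/
theorem lintegral_pd_sq_lt_top {f : E3 → ℝ} (hf : ContDiff ℝ 1 f) (hfc : HasCompactSupport f) (b : Fin 3) :
    ∫⁻ y, ‖pd b f y‖ₑ ^ (2 : ℝ) < ⊤ := by
  have hc : Continuous (pd b f) := by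
    unfold pd; exact (hf.continuous_fderiv one_ne_zero).clm_apply continuous_const
  have hm : MemLp (pd b f) 2 volume := hc.memLp_of_hasCompactSupport (hasCompactSupport_pd hfc b)
  rw [lintegral_enorm_sq_eq_eLpNorm_sq]
  exact ENNReal.rpow_lt_top_of_nonneg (by norm_num) hm.eLpNorm_lt_top.ne

/-- **The Calderón–Zygmund estimate for `∂_a S_η(∂_b f)`** (the gain-two term of (S3)): for `η ∈ C⁷` vanishing off
`B̄_R` there is `C < ∞` with `∫ |∂_a S_η(∂_b f)ᵢⱼ|² ≤ C ∫ |f|²` for all `f ∈ C²_c` supported in `B̄_ρ`.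
Proof: `∂_a S_η(∂_b f) = N_ε + 1_{B̄}T_ε(x, x) + 1_{B̄}E_ε − B_ε − L_ε` (`pd_bogovskiiS_pd_eq_add`,
`integral_truncK1_section_mul_pd_eq`, `czTerm_eq_frozen_add`); the four last terms are bounded in `L²` uniformly in
`ε` (Schur bounds and `exists_diagFrozenOp_l2Const`), while `‖N_ε‖₂ ≤ 9|B₁|A'ε ‖∂_b f‖₂ → 0`.
[cite: MaoOhTao2023, Lemma 2.3 (S3)] -/
theorem exists_czConst_pd_bogovskiiS_pd (hη : ContDiff ℝ 7 η) (hR : ∀ z : E3, R < ‖z‖ → η z = 0) (ρ : ℝ)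
    (i j a b : Fin 3) :
    ∃ C : ℝ≥0∞, C < ⊤ ∧ ∀ f : E3 → ℝ, ContDiff ℝ 2 f → HasCompactSupport f → (∀ y, f y ≠ 0 → ‖y‖ ≤ ρ) →
      ∫⁻ x, ‖pd a (bogovskiiS η (pd b f) i j) x‖ₑ ^ (2 : ℝ) ≤ C * ∫⁻ y, ‖f y‖ₑ ^ (2 : ℝ) := by
  have h1 : ContDiff ℝ 1 η := hη.of_le (by norm_cast)
  have h2 : ContDiff ℝ 2 η := hη.of_le (by norm_cast)
  have h3 : ContDiff ℝ 3 η := hη.of_le (by norm_cast)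
  obtain ⟨M, hM0, hM1, hM2, hM3⟩ := exists_bound_pd_le_three h3 hR
  have hMnn : 0 ≤ M := (abs_nonneg _).trans (hM0 0)
  obtain ⟨B, hB0, hB⟩ := exists_norm_fderiv_radialCutoff_le
  set V : ℝ := (volume : Measure E3).real (ball 0 1) with hV
  have hV0 : 0 ≤ V := measureReal_nonneg
  set Dx : ℝ := max (R + 2 * ρ) ρ with hDx
  set ζ : E3 → ℝ := (closedBall (0 : E3) Dx).indicator fun _ ↦ (1 : ℝ) with hζ
  have hζm : Measurable ζ := measurable_const.indicator measurableSet_closedBall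
  have hζ1 : ∀ x, |ζ x| ≤ 1 := by
    intro x; simp only [hζ, indicator]; split_ifs <;> simp
  have hζD : ∀ x : E3, Dx < ‖x‖ → ζ x = 0 := by
    intro x hx
    simp only [hζ]
    rw [indicator_of_notMem]
    rw [mem_closedBall, dist_zero_right, not_le]; exact hx
  obtain ⟨CT, hCT, hT⟩ := exists_diagFrozenOp_l2Const hη hR i j a b hζm hζ1 hζD
  -- the uniform constants
  set A' : ℝ := M * (4 * (max (R + ρ) 0) ^ 3 + 2 * (max (R + ρ) 0) ^ 4) with hA'
  set cB : ℝ≥0∞ := ENNReal.ofReal (B * A' * (27 * V)) with hcB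
  set cL : ℝ≥0∞ := ENNReal.ofReal (3 * V * A' * (max (R + ρ) 0 + 1)) with hcL
  set cE : ℝ≥0∞ := ENNReal.ofReal (3 * V * (3 * M * (4 * (max (R + max ρ Dx) 0) ^ 3 +
    8 * (max (R + max ρ Dx) 0) ^ 4 + 2 * (max (R + max ρ Dx) 0) ^ 5)) * (|Dx| + |ρ| + 1)) with hcE
  set CB : ℝ≥0∞ := cB ^ ((2 : ℝ) / 2) * cB with hCB
  set CL : ℝ≥0∞ := cL ^ ((2 : ℝ) / 2) * cL with hCL
  set CE : ℝ≥0∞ := cE ^ ((2 : ℝ) / 2) * cE with hCE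
  have hfin : ∀ c : ℝ≥0∞, c ≠ ⊤ → c ^ ((2 : ℝ) / 2) * c < ⊤ := fun c hc ↦
    ENNReal.mul_lt_top (ENNReal.rpow_lt_top_of_nonneg (by norm_num) hc) hc.lt_top
  set K : ℝ≥0∞ := 5 * (CT + CE + CB + CL) with hK
  have hKtop : K < ⊤ := by
    refine ENNReal.mul_lt_top (by norm_num) ?_
    simp only [ENNReal.add_lt_top]
    exact ⟨⟨⟨hCT, hfin _ ENNReal.ofReal_ne_top⟩, hfin _ ENNReal.ofReal_ne_top⟩, hfin _ ENNReal.ofReal_ne_top⟩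
  refine ⟨K, hKtop, fun f hf hfc hfρ ↦ ?_⟩
  have hf1 : ContDiff ℝ 1 f := hf.of_le (by norm_cast)
  have hfcn : Continuous f := hf.continuous
  have hpf : ContDiff ℝ 1 (pd b f) := contDiff_pd (n := 1) hf b
  have hpfc : HasCompactSupport (pd b f) := hasCompactSupport_pd hfc b
  have hpfcn : Continuous (pd b f) := hpf.continuous
  have hpfρ : ∀ y, pd b f y ≠ 0 → ‖y‖ ≤ ρ := norm_le_of_pd_ne_zero hfρ b
  set G : ℝ≥0∞ := ∫⁻ y, ‖f y‖ₑ ^ (2 : ℝ) with hG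
  set G₁ : ℝ≥0∞ := ∫⁻ y, ‖pd b f y‖ₑ ^ (2 : ℝ) with hG₁
  have hG₁ : G₁ < ⊤ := lintegral_pd_sq_lt_top hf1 hfc b
  set cN : ℝ := 3 * V * A' * 3 with hcN
  -- the key inequality for every `ε > 0`
  have hkey : ∀ ε : ℝ, 0 < ε → ∫⁻ x, ‖pd a (bogovskiiS η (pd b f) i j) x‖ₑ ^ (2 : ℝ) ≤
      K * G + 5 * (ENNReal.ofReal (cN * ε) ^ ((2 : ℝ) / 2) * ENNReal.ofReal (cN * ε)) * G₁ := by
    intro ε hε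
    -- the five pieces
    set N : E3 → ℝ := fun x ↦ ∫ y, radialCutoff ε (2 * ε) (x - y) * bogovskiiK1 η y i j a (x - y) * pd b f y with hN
    set Bt : E3 → ℝ := fun x ↦ ∫ y, fderiv ℝ (radialCutoff ε (2 * ε)) (x - y) (e b) *
      bogovskiiK1 η y i j a (x - y) * f y with hBt
    set Lt : E3 → ℝ := fun x ↦ ∫ y, (1 - radialCutoff ε (2 * ε) (x - y)) * bogovskiiK1 (pd b η) y i j a (x - y) * f y
      with hLt
    set Td : E3 → ℝ := fun x ↦ ζ x * ∫ t, (1 - radialCutoff ε (2 * ε) t) * bogovskiiK2 η x i j a b t * f (x - t)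
      with hTd
    set Et : E3 → ℝ := fun x ↦ ζ x * ∫ y, (1 - radialCutoff ε (2 * ε) (x - y)) *
      (bogovskiiK2 η y i j a b (x - y) - bogovskiiK2 η x i j a b (x - y)) * f y with hEt
    have hdec : ∀ x, pd a (bogovskiiS η (pd b f) i j) x = N x + (Td x + Et x - Bt x - Lt x) := by
      intro x
      rw [pd_bogovskiiS_pd_eq_add h3 hR hε hf hfc hfρ i j a b x, integral_truncK1_section_mul_pd_eq h3 hR hε hf1 hfc
        i j a b x, czTerm_eq_frozen_add h3 hR hε hfcn hfc hfρ i j a b x]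
      simp only [hN, hTd, hEt, hBt, hLt, hζ, hDx]
      ring
    have hpt : ∀ x, ‖pd a (bogovskiiS η (pd b f) i j) x‖ₑ ^ (2 : ℝ) ≤
        5 * (‖N x‖ₑ ^ (2 : ℝ) + ‖Td x‖ₑ ^ (2 : ℝ) + ‖Et x‖ₑ ^ (2 : ℝ) + ‖Bt x‖ₑ ^ (2 : ℝ) + ‖Lt x‖ₑ ^ (2 : ℝ)) := by
      intro x
      rw [hdec x]
      refine le_trans (ENNReal.rpow_le_rpow (z := 2) ?_ (by norm_num)) (enorm_sum_five_sq_le _ _ _ _ _)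
      calc ‖N x + (Td x + Et x - Bt x - Lt x)‖ₑ ≤ ‖N x‖ₑ + ‖Td x + Et x - Bt x - Lt x‖ₑ := enorm_add_le _ _
        _ ≤ ‖N x‖ₑ + (‖Td x + Et x - Bt x‖ₑ + ‖Lt x‖ₑ) := by gcongr; exact enorm_sub_le
        _ ≤ ‖N x‖ₑ + ((‖Td x + Et x‖ₑ + ‖Bt x‖ₑ) + ‖Lt x‖ₑ) := by gcongr; exact enorm_sub_le
        _ ≤ ‖N x‖ₑ + (((‖Td x‖ₑ + ‖Et x‖ₑ) + ‖Bt x‖ₑ) + ‖Lt x‖ₑ) := by gcongr; exact enorm_add_le _ _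
        _ = _ := by ring
    -- measurability of four of the five pieces
    have hθc : Continuous (radialCutoff ε (2 * ε) : E3 → ℝ) := (radialCutoff_contDiff (n := 0) ε (2 * ε)).continuous
    have hθ1 : ContDiff ℝ 1 (radialCutoff ε (2 * ε) : E3 → ℝ) := radialCutoff_contDiff ε (2 * ε)
    have mN : Measurable fun x ↦ ‖N x‖ₑ ^ (2 : ℝ) :=
      (measurable_K1op hθc h1 hpfcn i j a).enorm.pow_const _
    have mB : Measurable fun x ↦ ‖Bt x‖ₑ ^ (2 : ℝ) :=
      (measurable_K1op ((hθ1.continuous_fderiv one_ne_zero).clm_apply continuous_const) h1 hfcn i j a).enorm.pow_const _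
    obtain ⟨hbη, -⟩ := contDiff_pd_and_vanish (n := 1) h2 hR b
    have mL : Measurable fun x ↦ ‖Lt x‖ₑ ^ (2 : ℝ) :=
      (measurable_K1op (continuous_const.sub hθc) hbη hfcn i j a).enorm.pow_const _
    have mT : Measurable fun x ↦ ‖Td x‖ₑ ^ (2 : ℝ) := by
      have hm := measurable_frozenOp_uncurry h2 ε hfcn i j a b (g := f)
      have hdiag : Measurable fun x : E3 ↦
          ∫ t, (1 - radialCutoff ε (2 * ε) t) * bogovskiiK2 η x i j a b t * f (x - t) :=
        (hm.comp (measurable_id.prodMk measurable_id) :)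
      exact (hζm.mul hdiag).enorm.pow_const _
    -- integrate
    have hsum : ∫⁻ x, ‖pd a (bogovskiiS η (pd b f) i j) x‖ₑ ^ (2 : ℝ) ≤
        5 * ((∫⁻ x, ‖N x‖ₑ ^ (2 : ℝ)) + (∫⁻ x, ‖Td x‖ₑ ^ (2 : ℝ)) + (∫⁻ x, ‖Et x‖ₑ ^ (2 : ℝ)) +
          (∫⁻ x, ‖Bt x‖ₑ ^ (2 : ℝ)) + ∫⁻ x, ‖Lt x‖ₑ ^ (2 : ℝ)) := by
      calc _ ≤ ∫⁻ x, 5 * (‖N x‖ₑ ^ (2 : ℝ) + ‖Td x‖ₑ ^ (2 : ℝ) + ‖Et x‖ₑ ^ (2 : ℝ) + ‖Bt x‖ₑ ^ (2 : ℝ) +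
            ‖Lt x‖ₑ ^ (2 : ℝ)) := lintegral_mono hpt
        _ = 5 * ∫⁻ x, (‖N x‖ₑ ^ (2 : ℝ) + ‖Td x‖ₑ ^ (2 : ℝ) + ‖Et x‖ₑ ^ (2 : ℝ) + ‖Bt x‖ₑ ^ (2 : ℝ) +
            ‖Lt x‖ₑ ^ (2 : ℝ)) := by
            rw [lintegral_const_mul' _ _ (by norm_num)]
        _ = 5 * ((∫⁻ x, ‖N x‖ₑ ^ (2 : ℝ) + ‖Td x‖ₑ ^ (2 : ℝ) + ‖Et x‖ₑ ^ (2 : ℝ) + ‖Bt x‖ₑ ^ (2 : ℝ)) +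
            ∫⁻ x, ‖Lt x‖ₑ ^ (2 : ℝ)) := by
            congr 1
            rw [← lintegral_add_right _ mL]
        _ = 5 * ((∫⁻ x, ‖N x‖ₑ ^ (2 : ℝ) + ‖Td x‖ₑ ^ (2 : ℝ) + ‖Et x‖ₑ ^ (2 : ℝ)) + (∫⁻ x, ‖Bt x‖ₑ ^ (2 : ℝ)) +
            ∫⁻ x, ‖Lt x‖ₑ ^ (2 : ℝ)) := by
            congr 2
            rw [← lintegral_add_right _ mB]
        _ = 5 * ((∫⁻ x, ‖N x‖ₑ ^ (2 : ℝ) + ‖Td x‖ₑ ^ (2 : ℝ)) + (∫⁻ x, ‖Et x‖ₑ ^ (2 : ℝ)) +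
            (∫⁻ x, ‖Bt x‖ₑ ^ (2 : ℝ)) + ∫⁻ x, ‖Lt x‖ₑ ^ (2 : ℝ)) := by
            congr 3
            have mNT : Measurable fun x ↦ ‖N x‖ₑ ^ (2 : ℝ) + ‖Td x‖ₑ ^ (2 : ℝ) := mN.add mT
            rw [← lintegral_add_left mNT]
        _ = _ := by
            congr 4
            rw [← lintegral_add_left mN]
    -- the five bounds
    have bN := lintegral_sq_thetaK1_le h1 hR hM0 hM1 hε hpfcn.measurable hpfρ i j a
    have bB := lintegral_sq_dthetaK1_le h1 hR hM0 hM1 hB0 hB hε hfcn.measurable hfρ i j a b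
    have bL := lintegral_sq_truncK1pd_le h2 hR hM1 hM2 ε hfcn.measurable hfρ i j a b
    have bE := lintegral_sq_freezeError_le h3 hR hM1 hM2 hM3 ε (Dx := Dx) hfcn.measurable hfρ i j a b
    have bT := hT ε hε f hfcn hfc
    have bN' : ∫⁻ x, ‖N x‖ₑ ^ (2 : ℝ) ≤ ENNReal.ofReal (cN * ε) ^ ((2 : ℝ) / 2) * ENNReal.ofReal (cN * ε) * G₁ := by
      have : cN * ε = 3 * V * A' * (3 * ε) := by rw [hcN]; ring
      rw [this]; exact bN
    have bB' : ∫⁻ x, ‖Bt x‖ₑ ^ (2 : ℝ) ≤ CB * G := bB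
    have bL' : ∫⁻ x, ‖Lt x‖ₑ ^ (2 : ℝ) ≤ CL * G := bL
    have bE' : ∫⁻ x, ‖Et x‖ₑ ^ (2 : ℝ) ≤ CE * G := bE
    have bT' : ∫⁻ x, ‖Td x‖ₑ ^ (2 : ℝ) ≤ CT * G := bT
    calc _ ≤ _ := hsum
      _ ≤ 5 * ((ENNReal.ofReal (cN * ε) ^ ((2 : ℝ) / 2) * ENNReal.ofReal (cN * ε) * G₁) + CT * G + CE * G +
          CB * G + CL * G) := by gcongr
      _ = K * G + 5 * (ENNReal.ofReal (cN * ε) ^ ((2 : ℝ) / 2) * ENNReal.ofReal (cN * ε)) * G₁ := by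
          rw [hK]; ring
  -- let `ε → 0`
  have hlim : Tendsto (fun ε : ℝ ↦ K * G + 5 * (ENNReal.ofReal (cN * ε) ^ ((2 : ℝ) / 2) * ENNReal.ofReal (cN * ε)) * G₁)
      (𝓝[>] 0) (𝓝 (K * G)) := by
    have h0 : Tendsto (fun ε : ℝ ↦ ENNReal.ofReal (cN * ε)) (𝓝[>] 0) (𝓝 0) := by
      have : Tendsto (fun ε : ℝ ↦ cN * ε) (𝓝 0) (𝓝 (cN * 0)) := (continuous_const.mul continuous_id).tendsto 0
      rw [mul_zero] at this
      have h := ENNReal.tendsto_ofReal this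
      rw [ENNReal.ofReal_zero] at h
      exact h.mono_left nhdsWithin_le_nhds
    have h0' : Tendsto (fun ε : ℝ ↦ ENNReal.ofReal (cN * ε) ^ ((2 : ℝ) / 2)) (𝓝[>] 0) (𝓝 0) := by
      have : ∀ ε : ℝ, ENNReal.ofReal (cN * ε) ^ ((2 : ℝ) / 2) = ENNReal.ofReal (cN * ε) := by
        intro ε; norm_num
      simp only [this]; exact h0
    have hprod : Tendsto (fun ε : ℝ ↦ ENNReal.ofReal (cN * ε) ^ ((2 : ℝ) / 2) * ENNReal.ofReal (cN * ε)) (𝓝[>] 0)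
        (𝓝 (0 * 0)) := ENNReal.Tendsto.mul h0' (Or.inr ENNReal.zero_ne_top) h0 (Or.inr ENNReal.zero_ne_top)
    rw [zero_mul] at hprod
    have h5 : Tendsto (fun ε : ℝ ↦ 5 * (ENNReal.ofReal (cN * ε) ^ ((2 : ℝ) / 2) * ENNReal.ofReal (cN * ε)))
        (𝓝[>] 0) (𝓝 (5 * 0)) := ENNReal.Tendsto.const_mul hprod (Or.inr (by norm_num))
    rw [mul_zero] at h5
    have h5G : Tendsto (fun ε : ℝ ↦ 5 * (ENNReal.ofReal (cN * ε) ^ ((2 : ℝ) / 2) * ENNReal.ofReal (cN * ε)) * G₁)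
        (𝓝[>] 0) (𝓝 (0 * G₁)) := ENNReal.Tendsto.mul_const h5 (Or.inr hG₁.ne)
    rw [zero_mul] at h5G
    have := h5G.const_add (K * G)
    rwa [add_zero] at this
  refine ge_of_tendsto hlim ?_
  filter_upwards [self_mem_nhdsWithin] with ε hε
  exact hkey ε hε

end MainEstimate


section S3GainTwo

open scoped ENNReal

variable {η : E3 → ℝ} {R : ℝ}

/-- **(S3), gain of two derivatives at the `L²` level**: for `η ∈ C⁷` vanishing off `B̄_R` and every `ρ` there is
`C < ∞` with `∫ |∂_a∂_b (S_η f)ᵢⱼ|² ≤ C ∫ |f|²` for all `f ∈ C²_c` supported in `B̄_ρ` and all `i, j, a, b` — the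
operator `S_η` maps `L²(B̄_ρ)` boundedly into `Ḣ²` (Mao–Oh–Tao, Lemma 2.3, estimate (S3) with `s = 0`; the bound is
stated on the dense class `C²_c`). Proof: `∂_a∂_b S_η f = ∂_a S_{∂_bη} f + ∂_a S_η(∂_b f)`; the first term gains one
derivative (`exists_h1Const_bogovskiiS`), the second is the Calderón–Zygmund term (`exists_czConst_pd_bogovskiiS_pd`).
[cite: MaoOhTao2023, Lemma 2.3 (S3)] -/
theorem exists_h2Const_bogovskiiS (hη : ContDiff ℝ 7 η) (hR : ∀ z : E3, R < ‖z‖ → η z = 0) (ρ : ℝ) :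
    ∃ C : ℝ≥0∞, C < ⊤ ∧ ∀ (f : E3 → ℝ), ContDiff ℝ 2 f → HasCompactSupport f → (∀ y, f y ≠ 0 → ‖y‖ ≤ ρ) →
      ∀ i j a b : Fin 3,
        ∫⁻ x : E3, ‖pd a (pd b (bogovskiiS η f i j)) x‖ₑ ^ (2 : ℝ) ≤ C * ∫⁻ y : E3, ‖f y‖ₑ ^ (2 : ℝ) := by
  have h1 : ContDiff ℝ 1 η := hη.of_le (by norm_cast)
  have h2 : ContDiff ℝ 2 η := hη.of_le (by norm_cast)
  -- gain-one constants for the kernels `∂_bη`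
  have hb : ∀ b : Fin 3, ∃ C : ℝ≥0∞, C < ⊤ ∧ ∀ (f : E3 → ℝ), ContDiff ℝ 1 f → HasCompactSupport f →
      (∀ y, f y ≠ 0 → ‖y‖ ≤ max ρ (-R)) → ∀ i j m : Fin 3,
        ∫⁻ x : E3, ‖pd m (bogovskiiS (pd b η) f i j) x‖ₑ ^ (2 : ℝ) ≤ C * ∫⁻ y : E3, ‖f y‖ₑ ^ (2 : ℝ) := fun b ↦
    exists_h1Const_bogovskiiS (contDiff_pd (n := 1) h2 b) (pd_eta_admissible hR b) (ρ := max ρ (-R))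
      (by have := le_max_right ρ (-R); linarith)
  choose C1 hC1 hH1 using hb
  -- Calderón–Zygmund constants for all index quadruples
  have hq : ∀ q : Fin 3 × Fin 3 × Fin 3 × Fin 3, ∃ C : ℝ≥0∞, C < ⊤ ∧ ∀ f : E3 → ℝ, ContDiff ℝ 2 f →
      HasCompactSupport f → (∀ y, f y ≠ 0 → ‖y‖ ≤ ρ) →
        ∫⁻ x, ‖pd q.2.2.1 (bogovskiiS η (pd q.2.2.2 f) q.1 q.2.1) x‖ₑ ^ (2 : ℝ) ≤ C * ∫⁻ y, ‖f y‖ₑ ^ (2 : ℝ) :=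
    fun q ↦ exists_czConst_pd_bogovskiiS_pd hη hR ρ q.1 q.2.1 q.2.2.1 q.2.2.2
  choose C2 hC2 hH2 using hq
  set S1 : ℝ≥0∞ := Finset.univ.sup C1 with hS1
  set S2 : ℝ≥0∞ := Finset.univ.sup C2 with hS2
  have hS1top : S1 < ⊤ := (Finset.sup_lt_iff bot_lt_top).2 fun b _ ↦ hC1 b
  have hS2top : S2 < ⊤ := (Finset.sup_lt_iff bot_lt_top).2 fun q _ ↦ hC2 q
  refine ⟨2 * (S1 + S2), ENNReal.mul_lt_top (by norm_num) (ENNReal.add_lt_top.2 ⟨hS1top, hS2top⟩), ?_⟩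
  intro f hf hfc hfρ i j a b
  have hf1 : ContDiff ℝ 1 f := hf.of_le (by norm_cast)
  have hfρ' : ∀ y, f y ≠ 0 → ‖y‖ ≤ max ρ (-R) := fun y hy ↦ (hfρ y hy).trans (le_max_left _ _)
  have hpη : ContDiff ℝ 1 (pd b η) := contDiff_pd (n := 1) h2 b
  have hpf : ContDiff ℝ 1 (pd b f) := contDiff_pd (n := 1) hf b
  have hpfc : HasCompactSupport (pd b f) := hasCompactSupport_pd hfc b
  set u : E3 → ℝ := bogovskiiS (pd b η) f i j with hu
  set v : E3 → ℝ := bogovskiiS η (pd b f) i j with hv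
  have hu1 : ContDiff ℝ 1 u := contDiff_one_bogovskiiS hpη (pd_eta_admissible hR b) hf1 hfc i j
  have hv1 : ContDiff ℝ 1 v := contDiff_one_bogovskiiS h1 hR hpf hpfc i j
  have hsplit : ∀ x, pd a (pd b (bogovskiiS η f i j)) x = pd a u x + pd a v x := by
    intro x
    rw [pd_bogovskiiS h1 hR hf1 hfc i j b]
    exact pd_add ((hu1.differentiable one_ne_zero) x) ((hv1.differentiable one_ne_zero) x)
  have hmu : Measurable fun x ↦ ‖pd a u x‖ₑ ^ (2 : ℝ) := by
    have : Continuous (pd a u) := by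
      unfold pd; exact (hu1.continuous_fderiv one_ne_zero).clm_apply continuous_const
    exact this.measurable.enorm.pow_const _
  set G : ℝ≥0∞ := ∫⁻ y, ‖f y‖ₑ ^ (2 : ℝ) with hG
  have bu : ∫⁻ x, ‖pd a u x‖ₑ ^ (2 : ℝ) ≤ S1 * G :=
    (hH1 b f hf1 hfc hfρ' i j a).trans (by gcongr; exact Finset.le_sup (Finset.mem_univ b))
  have bv : ∫⁻ x, ‖pd a v x‖ₑ ^ (2 : ℝ) ≤ S2 * G :=
    (hH2 (i, j, a, b) f hf hfc hfρ).trans (by gcongr; exact Finset.le_sup (Finset.mem_univ (i, j, a, b)))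
  calc ∫⁻ x, ‖pd a (pd b (bogovskiiS η f i j)) x‖ₑ ^ (2 : ℝ)
      ≤ ∫⁻ x, 2 * (‖pd a u x‖ₑ ^ (2 : ℝ) + ‖pd a v x‖ₑ ^ (2 : ℝ)) := by
        refine lintegral_mono fun x ↦ ?_
        rw [hsplit x]
        exact (ENNReal.rpow_le_rpow (enorm_add_le _ _) (by norm_num)).trans (enorm_add_sq_le _ _)
    _ = 2 * ((∫⁻ x, ‖pd a u x‖ₑ ^ (2 : ℝ)) + ∫⁻ x, ‖pd a v x‖ₑ ^ (2 : ℝ)) := by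
        rw [lintegral_const_mul' _ _ (by norm_num), lintegral_add_left hmu]
    _ ≤ 2 * (S1 * G + S2 * G) := by gcongr
    _ = 2 * (S1 + S2) * G := by ring

end S3GainTwo

end MaoOhTao

end Literature.Geometry.Lorentzian
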